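import Literature.AlgebraicGeometry.Shioda1982.KoblitzOgusRelationsFortyPrime
import Literature.AlgebraicGeometry.Shioda1982.HodgeQuadruplesForty
import Literature.AlgebraicGeometry.Shioda1982.HodgeQuadruplesTwentyPrime
import HarnessLib

/-!
# The pair-free Hodge `4`-multisets of level `40p` (`p ≥ 19` prime) in Chinese-remainder coordinates

Topic `Literature/AlgebraicGeometry/Shioda1982`; the level `m = 40p = 8·5·p` of Shioda 1982, Lemma 1 / Prop. 4 (Q′) and Aoki–Shioda
1983, Theorem (𝔅²ₘ) (ii), one storey above the tree's `HodgeQuadruplesTwentyPrime` (`m = 20p`), on top of the relations of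
`KoblitzOgusRelationsFortyPrime` and of the kernel table `HodgeQuadruplesForty` (the `76` pair-free Hodge quadruples of level `40`:
Meyer–Neutsch's Tabelle 1 has the rows `(1, 21, 24, 34)`, `(1, 21, 26, 32)` at `N = 40` and `(1, 4, 17, 18)`, `(1, 6, 16, 17)`,
`(1, 9, 13, 17)`, `(1, 10, 12, 17)` at `N = 20`). THEOREM (no named fact, no `sorry`): **`classify_hodgeMultiset_fortyPrime`** — a
pair-free Hodge `4`-multiset `s` over `ℤ/40p`, `p ≥ 19` prime (`IsHodgeMultiset s`, Shioda's semigroup condition), is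
`{x, x + 20p, −2x, 20p}` or `{x, x + 20p, 2x + 20p, −4x}` for some residue `x` (Shioda's `αᵢ, βᵢ` with `m′ = 20p`; `3 ∤ m`, so there
is no `γ`), or `x·r` with `x = t·p`, `t` a unit of `ℤ/40`, and `r` one of the six shapes `(1, 21, 24, 34)`, `(1, 21, 26, 32)`,
`(2, 8, 34, 36)`, `(2, 12, 32, 34)`, `(2, 18, 26, 34)`, `(2, 20, 24, 34)` (together: the `42` multiples by `p` of the pair-free Hodge
quadruples of level `40` outside the two standard families) [cite: Shioda1982PicardFermat, §4 Lemma 1 p. 728, Prop. 4 (Q′) p. 729,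
table p. 727 (m = 40)]; [cite: AokiShioda1983, §2 Theorem (𝔅²ₘ) (ii) a), b)]; [cite: MeyerNeutsch1981Fermatquadrupel, Tabelle 1 p. 54
(N = 20, 40)]. Also public: the transfer `isHodgeMultiset_transfer_fortyPrime` (level `40p → 20p`). The bound `p ≥ 19` is inherited
from `classify_hodgeMultiset_twentyPrime`; the statement also holds at `p = 11, 13, 17` (cell `pub-hfermat`, brute force) and fails at
`p = 7` (lifts of the levels `56` and `28`).

## The proof (ours — four character relations in Chinese-remainder coordinates, the transfer to level `20p`, and the norm equations
at the units `pt(τ, 1)`, `pt(21τ, 1)`; NOT the printed inductive-structure argument; the text follows `HodgeQuadruplesTwentyPrime`)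

(1) RELATIONS. The four relation families of `KoblitzOgusRelationsFortyPrime` (from the tree's PROVED `KoblitzOgus.hodge_eq_combination`
[cite: Deligne1982HodgeCycles, Rem. 7.16 (a)]) see odd residues alone, in the coordinates `ℤ/40p ≅ ℤ/40 × ℤ/p` (`crtPt40`): the
single-fibre relations `Z_R`, `Z_I` (`relM8OmegaRe/Im_fortyPrime`, `= 0`), the two-fibre relation `E₈` (`relChi8_fortyPrime`, fibres
`c, 5c`, `= 0`) and the constant family `Γ₋₈` (fibres `c, 5c`) (`gammaM8_fortyPrime`); for a `4`-element multiset and `p ≥ 19` some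
parameter `c₀` has no member over `±c₀, ±5c₀`, so the constant one vanishes identically (`exists_free`, `rels0_of_rels`) — elementary
shadows of Aoki's criterion [cite: Aoki1983, Prop. 2.2]. They are evaluated on explicit multisets through six tables mod `40`
(`cZR_cons`, …; `decide`d table lemmas). Two consequences: `two_odd_core` (an odd two-element configuration `{x, y}` with `x` off the
fibre `pℤ/40p` has `y = x + 20p` — instances `Z_R(c)`, `Z_I(c)`, `E₈(c)`, `Γ₋₈(c)`, `E₈(c/5)`, `Γ₋₈(c/5)`) and `halfpair_odd`
(`{u₁, 20p − u₁, u₃, 20p − u₃}`, all odd, violates them). Only `n·a ≠ 0` in `ℤ/p` for `a ≠ 0` and `n ≤ 6` is used there.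
(2) TRANSFER. For a unit `u` of `ℤ/40p` also `u(1 + 20p)` is one; adding the two norm equations shows that `T(s)` = (odd members
mod `20p`) + 2·((even members)/2 mod `20p`) is a Hodge multiset of level `20p` (`isHodgeMultiset_transfer_fortyPrime`, verbatim the
argument of `isHodgeMultiset_transfer_twentyPrime`; the general form is the tree's `FermatCharacter.isHodgeMultiset_transfer_two`),
to which the tree's `classify_hodgeMultiset_twentyPrime` applies.
(3) CASES by the number of odd members (even, since `Σ = 0`). All members in `pℤ/40p`: `s = p·M` with `M` a pair-free Hodge quadruple
of level `40`, classified by the kernel table of `HodgeQuadruplesForty` (`fibre_zero`, via the tree's `liftBy` /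
`isHodgeMultiset_map_liftBy_iff`). No odd member: `s = 2σ` with `σ` a pair-free Hodge quadruple of level `20p`; double back
(`case_all_even`; twice a lifted level-`20` quadruple is a lifted level-`40` quadruple of the last four shapes). Two odd members `x, y`:
if one is off `pℤ`, then `y = x + 20p` by the relations (`two_odd_core`); if both are in `pℤ`, the units `pt(τ, 1)` and `pt(21τ, 1)`
agree on the even members and shift the odd ones by `20p`, so for every unit `τ` of `ℤ/40` exactly one of `⟨τk₁⟩, ⟨τk₂⟩ < 20`
(`x = k₁p, y = k₂p`), which forces `k₂ = k₁ + 20` again (`tab_half`, a kernel check over `ℤ/40`; `shift_of_fibre_zero`); in both cases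
`{x̄, ẑ, ŵ, 10p}` is then a Hodge quadruple of level `20p` — a pair in it means `s = α_x`, otherwise it is the level-`20p` `α_y` with
`y ∈ {x̄, x̄ + 10p}` and `s = β_x` (`10p ∉ β_y` is seen modulo `4`; a lifted level-`20` quadruple would put `s` inside `pℤ`)
(`case_two_odd`). Four odd members: `s̄ = s mod 20p` is a Hodge quadruple with odd members, hence not pair-free unless it is the lift
`tp·(1, 9, 13, 17)` inside `pℤ`, so `s` is a half-pair configuration, excluded by (1) (`case_all_odd`) — i.e. four odd members only
occur inside `pℤ/40p`.
Numerical companions (cell `pub-hfermat`, LIT g30, outside Lean; `code/lit/picard/check40.py`, `fibre0_two_odd.py`): the eight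
odd-supported families of level `40p` hold on all `328 / 476` pair-free Hodge `4`-multisets of the levels `280, 440`; at `m = 440`
these are `200` α/β with no odd member, `200` with two odd members, and the `76` lifted level-`40` quadruples, `0` other; no
pair-free Hodge quadruple of level `40p`, `p ∈ {13, 17, 19, 23}`, has its two odd members in `pℤ` and an even member outside.

HONEST FRAMING (cell `pub-hfermat`): explicit algebraic cycles for specific Hodge classes on Fermat/Delsarte varieties; residual open
instances listed; no claim on general Hodge. (This file reproduces a printed structure theorem; the proof route is this formalisation's.)

## References
* [Shioda1982PicardFermat] T. Shioda, *On the Picard number of a Fermat surface*, J. Fac. Sci. Univ. Tokyo IA **28** (1982) 725–734,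
  §4 Lemma 1 p. 728, Prop. 4 (Q′) p. 729, table p. 727 (row `m = 40`).
* [AokiShioda1983] N. Aoki, T. Shioda, *Generators of the Néron–Severi group of a Fermat surface*, Progr. Math. 35 (1983), §2
  Theorem (𝔅²ₘ) (ii).
* [MeyerNeutsch1981Fermatquadrupel] W. Meyer, W. Neutsch, *Fermatquadrupel*, Math. Ann. 256 (1981) 51–62, Tabelle 1 p. 54 (rows `N = 20, 40`).
* [Aoki1983] N. Aoki, Math. Ann. 266 (1983) 23–54, Prop. 2.2.
* [Deligne1982HodgeCycles] P. Deligne, LNM 900 (1982), Rem. 7.16 (a) (Koblitz–Ogus), through `KoblitzOgusRelationsFortyPrime`.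
* [Shioda1979PJA] T. Shioda, Proc. Japan Acad. 55A (1979), §1 eq. (2) (the Hodge condition).
-/

namespace Literature.AlgebraicGeometry.Shioda1982

open Finset Multiset
open Literature.AlgebraicGeometry.HodgeTheory Literature.AlgebraicGeometry.HodgeTheory.FermatCharacter

section FortyPrimeClassification

variable {p : ℕ}

set_option linter.unusedSimpArgs false -- uniform simp sets across the case analyses (as in `HodgeQuadruplesTwentyPrime`)

/-! ### `ℤ/40p ≅ ℤ/40 × ℤ/p`: Chinese-remainder coordinates (as in `KoblitzOgusRelationsFortyPrime`) -/

-- BEGIN DUP (verbatim pattern from HodgeQuadruplesTwentyPrime.lean; private there)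
/-- The Chinese-remainder isomorphism `ℤ/40p ≃+* ℤ/40 × ℤ/p`. [folklore] -/
private def crt (h : Nat.Coprime 40 p) : ZMod (40 * p) ≃+* ZMod 40 × ZMod p := ZMod.chineseRemainder h

/-- The residue with coordinates `(e, b)`. [folklore] -/
private def pt (h : Nat.Coprime 40 p) (e : ZMod 40) (b : ZMod p) : ZMod (40 * p) := (crt h).symm (e, b)

/-- First coordinate = residue mod `40`. [folklore] -/
private theorem crt_fst (h : Nat.Coprime 40 p) [NeZero (40 * p)] (w : ZMod (40 * p)) :
    (crt h w).1 = (w.val : ZMod 40) := by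
  conv_lhs => rw [← ZMod.natCast_zmod_val w]
  rw [map_natCast, Prod.fst_natCast]

/-- Second coordinate = residue mod `p`. [folklore] -/
private theorem crt_snd (h : Nat.Coprime 40 p) [NeZero (40 * p)] (w : ZMod (40 * p)) :
    (crt h w).2 = (w.val : ZMod p) := by
  conv_lhs => rw [← ZMod.natCast_zmod_val w]
  rw [map_natCast, Prod.snd_natCast]

/-- `crt (pt e b) = (e, b)`. [folklore] -/
private theorem crt_pt (h : Nat.Coprime 40 p) (e : ZMod 40) (b : ZMod p) : crt h (pt h e b) = (e, b) :=
  (crt h).apply_symm_apply (e, b)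

/-- `pt (crt w) = w`. [folklore] -/
private theorem pt_crt (h : Nat.Coprime 40 p) (w : ZMod (40 * p)) : pt h (crt h w).1 (crt h w).2 = w :=
  (crt h).symm_apply_apply w

/-- `pt` is injective. [folklore] -/
private theorem pt_inj (h : Nat.Coprime 40 p) {e e' : ZMod 40} {b b' : ZMod p} :
    pt h e b = pt h e' b' ↔ e = e' ∧ b = b' := by
  rw [pt, pt, (crt h).symm.injective.eq_iff, Prod.mk.injEq]

/-- `pt` and negation. [folklore] -/
private theorem neg_pt (h : Nat.Coprime 40 p) (e : ZMod 40) (b : ZMod p) : -pt h e b = pt h (-e) (-b) := by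
  rw [pt, pt, ← (crt h).symm.map_neg, Prod.neg_mk]

/-- `pt` and natural multiples. [folklore] -/
private theorem natCast_mul_pt (h : Nat.Coprime 40 p) (k : ℕ) (e : ZMod 40) (b : ZMod p) :
    (k : ZMod (40 * p)) * pt h e b = pt h (k * e) (k * b) := by
  rw [pt, pt, ← nsmul_eq_mul, ← _root_.map_nsmul, Prod.smul_mk, nsmul_eq_mul, nsmul_eq_mul]

/-- `(40, p) = 1` for a prime `p ≥ 7`. [folklore] -/
private theorem coprime_forty (hp : p.Prime) (h7 : 7 ≤ p) : Nat.Coprime 40 p := by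
  have h2 : Nat.Coprime 2 p := (Nat.coprime_primes Nat.prime_two hp).2 (by omega)
  have h5 : Nat.Coprime 5 p := (Nat.coprime_primes (by decide) hp).2 (by omega)
  have h4 : Nat.Coprime 4 p := Nat.Coprime.mul_left h2 h2
  have h8 : Nat.Coprime 8 p := Nat.Coprime.mul_left h2 h4
  exact Nat.Coprime.mul_left h8 h5

/-- `pt` is additive. [folklore] -/
private theorem pt_add (h : Nat.Coprime 40 p) (e e' : ZMod 40) (b b' : ZMod p) :
    pt h e b + pt h e' b' = pt h (e + e') (b + b') := by
  rw [pt, pt, pt, ← (crt h).symm.map_add, Prod.mk_add_mk]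

/-- `pt` is multiplicative. [folklore] -/
private theorem pt_mul (h : Nat.Coprime 40 p) (e e' : ZMod 40) (b b' : ZMod p) :
    pt h e b * pt h e' b' = pt h (e * e') (b * b') := by
  rw [pt, pt, pt, ← (crt h).symm.map_mul, Prod.mk_mul_mk]

/-- `⟨pt e b⟩ mod 40` is `⟨e⟩`. [folklore] -/
private theorem val_pt_mod_forty (h : Nat.Coprime 40 p) [NeZero (40 * p)] (e : ZMod 40) (b : ZMod p) :
    (pt h e b).val % 40 = e.val := by
  have := crt_fst h (pt h e b)
  rw [crt_pt] at this
  have h2 := congrArg ZMod.val this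
  rw [ZMod.val_natCast] at h2
  exact h2.symm

/-- `⟨pt e b⟩ mod p` is `b`. [folklore] -/
private theorem natCast_val_pt (h : Nat.Coprime 40 p) [NeZero (40 * p)] (e : ZMod 40) (b : ZMod p) :
    (((pt h e b).val : ℕ) : ZMod p) = b := by
  have := crt_snd h (pt h e b)
  rw [crt_pt] at this
  exact this.symm

/-- `⟨pt e b⟩ mod 2` is `⟨e⟩ mod 2`. [folklore] -/
private theorem val_pt_mod_two (h : Nat.Coprime 40 p) [NeZero (40 * p)] (e : ZMod 40) (b : ZMod p) :
    (pt h e b).val % 2 = e.val % 2 := by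
  rw [← Nat.mod_mod_of_dvd _ (by norm_num : 2 ∣ 40), val_pt_mod_forty]
-- END DUP

/-- The prime `p` as a residue mod `40`. -/
local notation "π" => ((p : ℕ) : ZMod 40)

/-- `crt p = (p mod 40, 0)`. [folklore] -/
private theorem crt_P (h : Nat.Coprime 40 p) [NeZero (40 * p)] : crt h (p : ZMod (40 * p)) = (π, 0) := by
  rw [Prod.ext_iff, crt_fst, crt_snd, ZMod.val_natCast]
  have hp40 : p % (40 * p) = p := Nat.mod_eq_of_lt (by have := NeZero.ne (40 * p); omega)
  rw [hp40]
  exact ⟨rfl, ZMod.natCast_self p⟩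

/-- `p = pt (p mod 40) 0`. [folklore] -/
private theorem P_eq_pt (h : Nat.Coprime 40 p) [NeZero (40 * p)] : (p : ZMod (40 * p)) = pt h π 0 := by
  rw [← pt_crt h (p : ZMod (40 * p)), crt_P]

/-- `p mod 40` is a unit residue for a prime `p ≥ 7`. [folklore] -/
private theorem pi_eq (hp : p.Prime) (h7 : 7 ≤ p) :
    π = 1 ∨ π = 3 ∨ π = 7 ∨ π = 9 ∨ π = 11 ∨ π = 13 ∨ π = 17 ∨ π = 19 ∨ π = 21 ∨ π = 23 ∨ π = 27 ∨ π = 29 ∨ π = 31 ∨ π = 33 ∨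
      π = 37 ∨ π = 39 := by
  have h2 : ¬ 2 ∣ p := fun h ↦ by
    have := (Nat.prime_dvd_prime_iff_eq Nat.prime_two hp).1 h; omega
  have h5 : ¬ 5 ∣ p := fun h ↦ by
    have := (Nat.prime_dvd_prime_iff_eq (by decide : Nat.Prime 5) hp).1 h; omega
  have h40 : p % 40 = 1 ∨ p % 40 = 3 ∨ p % 40 = 7 ∨ p % 40 = 9 ∨ p % 40 = 11 ∨ p % 40 = 13 ∨ p % 40 = 17 ∨ p % 40 = 19 ∨
      p % 40 = 21 ∨ p % 40 = 23 ∨ p % 40 = 27 ∨ p % 40 = 29 ∨ p % 40 = 31 ∨ p % 40 = 33 ∨ p % 40 = 37 ∨ p % 40 = 39 := by omega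
  rw [← ZMod.natCast_mod p 40]
  rcases h40 with e | e | e | e | e | e | e | e | e | e | e | e | e | e | e | e <;> rw [e] <;> decide

/-- `20π = 20` in `ℤ/40` (`p` odd). [folklore] -/
private theorem twenty_mul_pi (hp : p.Prime) (h7 : 7 ≤ p) : (20 : ZMod 40) * π = 20 := by
  rcases pi_eq hp h7 with h | h | h | h | h | h | h | h | h | h | h | h | h | h | h | h <;> rw [h] <;> decide

/-- `k·p = pt (kπ) 0`. [folklore] -/
private theorem natCast_mul_P (h : Nat.Coprime 40 p) [NeZero (40 * p)] (k : ℕ) :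
    ((k * p : ℕ) : ZMod (40 * p)) = pt h (k * π) 0 := by
  rw [Nat.cast_mul, P_eq_pt h, natCast_mul_pt, mul_zero]

/-- `20p = pt 20 0`. [folklore] -/
private theorem twentyP_eq_pt (h : Nat.Coprime 40 p) [NeZero (40 * p)] (hp : p.Prime) (h7 : 7 ≤ p) :
    ((20 * p : ℕ) : ZMod (40 * p)) = pt h 20 0 := by
  rw [natCast_mul_P h, Nat.cast_ofNat, twenty_mul_pi hp h7]

/-- `pt 1 1 = 1`. [folklore] -/
private theorem pt_one (h : Nat.Coprime 40 p) : pt h 1 1 = 1 := by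
  show (crt h).symm (1, 1) = 1
  exact _root_.map_one (crt h).symm

/-- `pt 0 0 = 0`. [folklore] -/
private theorem pt_zero (h : Nat.Coprime 40 p) : pt h 0 0 = 0 := by
  show (crt h).symm (0, 0) = 0
  exact _root_.map_zero (crt h).symm

/-- `pt u 1` is a unit when `u v = 1` in `ℤ/40`. [folklore] -/
private theorem isUnit_pt (h : Nat.Coprime 40 p) {u v : ZMod 40} (hu : u * v = 1) : IsUnit (pt h u 1) :=
  IsUnit.of_mul_eq_one (pt h v 1) (by rw [pt_mul, hu, mul_one, pt_one])

/-- `pt 1 b` is a unit for `b ≠ 0` (`p` prime). [folklore] -/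
private theorem isUnit_pt_one (h : Nat.Coprime 40 p) (hp : p.Prime) {b : ZMod p} (hb : b ≠ 0) : IsUnit (pt h 1 b) := by
  haveI := Fact.mk hp
  exact IsUnit.of_mul_eq_one (pt h 1 b⁻¹) (by rw [pt_mul, mul_one, mul_inv_cancel₀ hb, pt_one])

/-- The parity of the first coordinate is the parity of the residue. [folklore] -/
private theorem fst_val_mod_two (h : Nat.Coprime 40 p) [NeZero (40 * p)] (w : ZMod (40 * p)) :
    (crt h w).1.val % 2 = w.val % 2 := by
  rw [crt_fst, ZMod.val_natCast, Nat.mod_mod_of_dvd _ (by norm_num : 2 ∣ 40)]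

/-! ### Small multiples in `ℤ/p` -/

/-- `n ≠ 0` in `ℤ/p` for `0 < n < p`. [folklore] -/
private theorem natCast_ne_zero_of_lt {n : ℕ} (h0 : 0 < n) (hn : n < p) : (n : ZMod p) ≠ 0 := by
  intro h
  rw [ZMod.natCast_eq_zero_iff] at h
  exact absurd (Nat.le_of_dvd h0 h) (by omega)

/-- `n·a ≠ 0` for `a ≠ 0` and `0 < n < p` (`p` prime). [folklore] -/
private theorem mul_ne_zero_of_lt (hp : p.Prime) {a : ZMod p} (ha : a ≠ 0) {n : ℕ} (h0 : 0 < n) (hn : n < p) :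
    (n : ZMod p) * a ≠ 0 := by
  haveI := Fact.mk hp
  exact mul_ne_zero (natCast_ne_zero_of_lt h0 hn) ha


/-! ### The odd part in coordinates; the four functionals used and their tables mod `40` -/

/-- The odd part of the multiplicity function of `T : Multiset (ℤ/40 × ℤ/p)`: `o(q) = #_q T − #_{−q} T`. [folklore] -/
private def oc (T : Multiset (ZMod 40 × ZMod p)) (q : ZMod 40 × ZMod p) : ℤ := (count q T : ℤ) - count (-q) T

/-- `oddCt` at a coordinate point is the odd part of `s.map crt`. [folklore] -/
private theorem oddCt_crtPt40 (h : Nat.Coprime 40 p) (s : Multiset (ZMod (40 * p))) (e : ZMod 40) (c : ZMod p) :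
    oddCt s (crtPt40 h e c) = oc (s.map (crt h)) (e, c) := by
  classical
  have hc : ∀ q : ZMod 40 × ZMod p, count q (s.map (crt h)) = count ((crt h).symm q) s := fun q ↦ by
    rw [← Multiset.count_map_eq_count' _ _ (crt h).symm.injective, Multiset.map_map]
    simp only [Function.comp_def, RingEquiv.symm_apply_apply, Multiset.map_id']
  simp only [oddCt, oc, hc]
  show (count ((crt h).symm (e, c)) s : ℤ) - count (-(crt h).symm (e, c)) s =
    count ((crt h).symm (e, c)) s - count ((crt h).symm (-(e, c))) s
  rw [map_neg]

/-- Table of `Z_R = ô(1,·) − ô(9,·) + ô(11,·) − ô(19,·) − ô(21,·) + ô(29,·) − ô(31,·) + ô(39,·)` (`Re χ₋₈ω`; even under `e ↦ −e`). [folklore] -/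
private def tZR (e : ZMod 40) : ℤ :=
  if e.val = 1 ∨ e.val = 11 ∨ e.val = 29 ∨ e.val = 39 then 1
  else if e.val = 9 ∨ e.val = 19 ∨ e.val = 21 ∨ e.val = 31 then -1
  else 0

/-- Table of `Z_I = −ô(3,·) − ô(7,·) + ô(13,·) + ô(17,·) + ô(23,·) + ô(27,·) − ô(33,·) − ô(37,·)` (`Im χ₋₈ω`; even under `e ↦ −e`). [folklore] -/
private def tZI (e : ZMod 40) : ℤ :=
  if e.val = 13 ∨ e.val = 17 ∨ e.val = 23 ∨ e.val = 27 then 1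
  else if e.val = 3 ∨ e.val = 7 ∨ e.val = 33 ∨ e.val = 37 then -1
  else 0

/-- The even character `χ₈` on the units of `ℤ/40` (`0` elsewhere): the weights of `E₈` in the fibre `c`. [folklore] -/
private def tE8u (e : ZMod 40) : ℤ :=
  if e.val = 1 ∨ e.val = 7 ∨ e.val = 9 ∨ e.val = 17 ∨ e.val = 23 ∨ e.val = 31 ∨ e.val = 33 ∨ e.val = 39 then 1
  else if e.val = 3 ∨ e.val = 11 ∨ e.val = 13 ∨ e.val = 19 ∨ e.val = 21 ∨ e.val = 27 ∨ e.val = 29 ∨ e.val = 37 then -1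
  else 0

/-- The weights of `E₈` in the fibre `5c`: `χ₈(u)` on units and `4χ₈(v/5)` on `v ∈ {5, 15, 25, 35}` (even under `e ↦ −e`). [folklore] -/
private def tE8f (e : ZMod 40) : ℤ :=
  if e.val = 1 ∨ e.val = 7 ∨ e.val = 9 ∨ e.val = 17 ∨ e.val = 23 ∨ e.val = 31 ∨ e.val = 33 ∨ e.val = 39 then 1
  else if e.val = 3 ∨ e.val = 11 ∨ e.val = 13 ∨ e.val = 19 ∨ e.val = 21 ∨ e.val = 27 ∨ e.val = 29 ∨ e.val = 37 then -1
  else if e.val = 5 ∨ e.val = 35 then 4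
  else if e.val = 15 ∨ e.val = 25 then -4
  else 0

/-- The weights `4χ₈(v/5)` on `v ∈ {5, 15, 25, 35}` (`0` elsewhere). [folklore] -/
private def tE8c (e : ZMod 40) : ℤ :=
  if e.val = 5 ∨ e.val = 35 then 4
  else if e.val = 15 ∨ e.val = 25 then -4
  else 0

/-- Minus the odd character `χ₋₈` on the units of `ℤ/40` (`0` elsewhere): the weights of `Γ₋₈` in the fibre `c`. [folklore] -/
private def tG8u (e : ZMod 40) : ℤ :=
  if e.val = 7 ∨ e.val = 13 ∨ e.val = 21 ∨ e.val = 23 ∨ e.val = 29 ∨ e.val = 31 ∨ e.val = 37 ∨ e.val = 39 then 1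
  else if e.val = 1 ∨ e.val = 3 ∨ e.val = 9 ∨ e.val = 11 ∨ e.val = 17 ∨ e.val = 19 ∨ e.val = 27 ∨ e.val = 33 then -1
  else 0

/-- The weights of `Γ₋₈` in the fibre `5c`: `−χ₋₈(u)` on units and `−4χ₋₈(v/5)` on `v ∈ {5, 15, 25, 35}` (odd under `e ↦ −e`). [folklore] -/
private def tG8f (e : ZMod 40) : ℤ :=
  if e.val = 7 ∨ e.val = 13 ∨ e.val = 21 ∨ e.val = 23 ∨ e.val = 29 ∨ e.val = 31 ∨ e.val = 37 ∨ e.val = 39 then 1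
  else if e.val = 1 ∨ e.val = 3 ∨ e.val = 9 ∨ e.val = 11 ∨ e.val = 17 ∨ e.val = 19 ∨ e.val = 27 ∨ e.val = 33 then -1
  else if e.val = 25 ∨ e.val = 35 then 4
  else if e.val = 5 ∨ e.val = 15 then -4
  else 0

/-- The weights `−4χ₋₈(v/5)` on `v ∈ {5, 15, 25, 35}` (`0` elsewhere). [folklore] -/
private def tG8c (e : ZMod 40) : ℤ :=
  if e.val = 25 ∨ e.val = 35 then 4
  else if e.val = 5 ∨ e.val = 15 then -4
  else 0

/-- `tE8f = tE8u + tE8c` (kernel check). [folklore] -/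
private theorem tE8f_eq : ∀ e : ZMod 40, tE8f e = tE8u e + tE8c e := by decide

/-- `tG8f = tG8u + tG8c` (kernel check). [folklore] -/
private theorem tG8f_eq : ∀ e : ZMod 40, tG8f e = tG8u e + tG8c e := by decide

variable (T : Multiset (ZMod 40 × ZMod p))

/-- `Z_R(b)` in coordinates. [folklore] -/
private def cZR (b : ZMod p) : ℤ :=
  oc T (1, b) - oc T (9, b) + oc T (11, b) - oc T (19, b) - oc T (21, b) + oc T (29, b) - oc T (31, b) + oc T (39,
    b)

/-- `Z_I(b)` in coordinates. [folklore] -/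
private def cZI (b : ZMod p) : ℤ :=
  -oc T (3, b) - oc T (7, b) + oc T (13, b) + oc T (17, b) + oc T (23, b) + oc T (27, b) - oc T (33, b) - oc T (37,
    b)

/-- The unit part of `E₈` at the fibre `b`: `Σ_{u∈U} χ₈(u) ô(u, b)`. [folklore] -/
private def cE8a (b : ZMod p) : ℤ :=
  oc T (1, b) - oc T (3, b) + oc T (7, b) + oc T (9, b) - oc T (11, b) - oc T (13, b) + oc T (17, b) - oc T (19, b)
    - oc T (21, b) + oc T (23, b) - oc T (27, b) - oc T (29, b) + oc T (31, b) + oc T (33, b) - oc T (37, b) + oc T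
    (39, b)

/-- The `F`-part of `E₈` at the fibre `b`: `4 Σ_{v∈F} χ₈(v/5) ô(v, b)`. [folklore] -/
private def cE8c (b : ZMod p) : ℤ :=
  4 * oc T (5, b) - 4 * oc T (15, b) - 4 * oc T (25, b) + 4 * oc T (35, b)

/-- `E₈(b) = E₈ᵘ(b) + E₈ᵘ(5b) + E₈ᶠ(5b)` in coordinates (fibres `b`, `5b`). [folklore] -/
private def cE8 (b : ZMod p) : ℤ := cE8a T b + cE8a T (5 * b) + cE8c T (5 * b)

/-- The unit part of `Γ₋₈` at the fibre `b`: `−Σ_{u∈U} χ₋₈(u) ô(u, b)`. [folklore] -/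
private def cG8a (b : ZMod p) : ℤ :=
  -oc T (1, b) - oc T (3, b) + oc T (7, b) - oc T (9, b) - oc T (11, b) + oc T (13, b) - oc T (17, b) - oc T (19, b)
    + oc T (21, b) + oc T (23, b) - oc T (27, b) + oc T (29, b) + oc T (31, b) - oc T (33, b) + oc T (37, b) + oc T
    (39, b)

/-- The `F`-part of `Γ₋₈` at the fibre `b`: `−4 Σ_{v∈F} χ₋₈(v/5) ô(v, b)`. [folklore] -/
private def cG8c (b : ZMod p) : ℤ :=
  -(4 * oc T (5, b)) - 4 * oc T (15, b) + 4 * oc T (25, b) + 4 * oc T (35, b)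

/-- `Γ₋₈(b) = Γ₋₈ᵘ(b) + Γ₋₈ᵘ(5b) + Γ₋₈ᶠ(5b)` in coordinates (the tree's `gammaM8Sum40`; fibres `b`, `5b`). [folklore] -/
private def cG8 (b : ZMod p) : ℤ := cG8a T b + cG8a T (5 * b) + cG8c T (5 * b)

/-- The four relation families used, on the coordinates of a Hodge multiset of level `40p`: `Z_R = Z_I = E₈ = 0` fibrewise,
`Γ₋₈` constant. [folklore] -/
private structure Rels (T : Multiset (ZMod 40 × ZMod p)) : Prop where
  zr : ∀ b : ZMod p, b ≠ 0 → cZR T b = 0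
  zi : ∀ b : ZMod p, b ≠ 0 → cZI T b = 0
  e8 : ∀ b : ZMod p, b ≠ 0 → cE8 T b = 0
  g8 : ∀ b b' : ZMod p, b ≠ 0 → b' ≠ 0 → cG8 T b = cG8 T b'

/-- The same with `Γ₋₈ ≡ 0`. [folklore] -/
private structure Rels0 (T : Multiset (ZMod 40 × ZMod p)) : Prop where
  zr : ∀ b : ZMod p, b ≠ 0 → cZR T b = 0
  zi : ∀ b : ZMod p, b ≠ 0 → cZI T b = 0
  e8 : ∀ b : ZMod p, b ≠ 0 → cE8 T b = 0
  g8 : ∀ b : ZMod p, b ≠ 0 → cG8 T b = 0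

variable {T}

/-- **The relations `Z_R`, `Z_I`, `E₈`, `Γ₋₈` for the coordinates of a Hodge multiset of level `40p`** (the tree's
`relM8OmegaRe/relM8OmegaIm/relChi8/gammaM8_fortyPrime`). [cite: Deligne1982HodgeCycles, Rem. 7.16 (a)] [cite: Aoki1983, Prop. 2.2] -/
private theorem rels_of_isHodgeMultiset (h : Nat.Coprime 40 p) [NeZero (40 * p)] (hp : p.Prime) (h7 : 7 ≤ p)
    {s : Multiset (ZMod (40 * p))} (hs : IsHodgeMultiset s) : Rels (s.map (crt h)) := by
  refine ⟨fun b hb ↦ ?_, fun b hb ↦ ?_, fun b hb ↦ ?_, fun b b' hb hb' ↦ ?_⟩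
  · have key := relM8OmegaRe_fortyPrime hp h7 h hs hb
    simp only [oddCt_crtPt40] at key
    simp only [cZR]
    linear_combination key
  · have key := relM8OmegaIm_fortyPrime hp h7 h hs hb
    simp only [oddCt_crtPt40] at key
    simp only [cZI]
    linear_combination key
  · have key := relChi8_fortyPrime hp h7 h hs hb
    simp only [oddCt_crtPt40] at key
    simp only [cE8, cE8a, cE8c]
    linear_combination key
  · have key := gammaM8_fortyPrime hp h7 h hs hb hb'
    simp only [gammaM8Sum40, oddCt_crtPt40] at key
    simp only [cG8, cG8a, cG8c]
    linear_combination key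

/-! ### `Γ₋₈ ≡ 0`: a parameter whose fibres carry no member -/

/-- `o(u, x) = 0` when no member lies over `±x`. [folklore] -/
private theorem oc_eq_zero_of_free {T : Multiset (ZMod 40 × ZMod p)} {x : ZMod p}
    (hx : ∀ q ∈ T, q.2 ≠ x ∧ q.2 ≠ -x) (u : ZMod 40) : oc T (u, x) = 0 := by
  classical
  have h1 : count (u, x) T = 0 := Multiset.count_eq_zero.mpr fun hm ↦ (hx _ hm).1 rfl
  have h2 : count (-u, -x) T = 0 := Multiset.count_eq_zero.mpr fun hm ↦ (hx _ hm).2 rfl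
  simp [oc, Prod.neg_mk, h1, h2]

/-- **For a `4`-element coordinate multiset and `p ≥ 19` some `c₀ ≠ 0` has no member over `±c₀, ±5c₀`** (at most `16`
parameters are excluded). [folklore] -/
private theorem exists_free (hp : p.Prime) (h19 : 19 ≤ p) (T : Multiset (ZMod 40 × ZMod p)) (hT : card T = 4) :
    ∃ c : ZMod p, c ≠ 0 ∧ (∀ q ∈ T, q.2 ≠ c ∧ q.2 ≠ -c) ∧ ∀ q ∈ T, q.2 ≠ 5 * c ∧ q.2 ≠ -(5 * c) := by
  classical
  haveI := Fact.mk hp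
  have h5 : (5 : ZMod p) ≠ 0 := by exact_mod_cast natCast_ne_zero_of_lt (p := p) (n := 5) (by norm_num) (by omega)
  let B : Finset (ZMod p) := {0} ∪ ((T.map fun q ↦ q.2).toFinset ∪ (T.map fun q ↦ -q.2).toFinset ∪
      ((T.map fun q ↦ 5⁻¹ * q.2).toFinset ∪ (T.map fun q ↦ -(5⁻¹ * q.2)).toFinset))
  have hB : B.card ≤ 17 := by
    have c1 : ∀ g : ZMod 40 × ZMod p → ZMod p, ((T.map g).toFinset).card ≤ 4 := fun g ↦
      (Multiset.toFinset_card_le _).trans (by rw [Multiset.card_map, hT])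
    calc B.card ≤ ({0} : Finset (ZMod p)).card + (((T.map fun q ↦ q.2).toFinset ∪ (T.map fun q ↦ -q.2).toFinset ∪
          ((T.map fun q ↦ 5⁻¹ * q.2).toFinset ∪ (T.map fun q ↦ -(5⁻¹ * q.2)).toFinset))).card := Finset.card_union_le _ _
      _ ≤ 1 + (4 + 4 + (4 + 4)) := by
          gcongr
          · simp
          · exact (Finset.card_union_le _ _).trans (add_le_add ((Finset.card_union_le _ _).trans (add_le_add (c1 _) (c1 _)))
              ((Finset.card_union_le _ _).trans (add_le_add (c1 _) (c1 _))))
      _ = 17 := by norm_num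
  by_contra hcon
  push Not at hcon
  have hsub : (Finset.univ : Finset (ZMod p)) ⊆ B := by
    intro c _
    by_cases hc0 : c = 0
    · simp [B, hc0]
    have hc := hcon c hc0
    simp only [B, Finset.mem_union, Finset.mem_singleton, Multiset.mem_toFinset, Multiset.mem_map]
    by_cases hA : ∀ q ∈ T, q.2 ≠ c ∧ q.2 ≠ -c
    · obtain ⟨q, hq, hq'⟩ := hc hA
      by_cases e1 : q.2 = 5 * c
      · right; right; left; exact ⟨q, hq, by rw [e1, inv_mul_cancel_left₀ h5]⟩
      · have e2 : q.2 = -(5 * c) := hq' e1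
        right; right; right; exact ⟨q, hq, by rw [e2, mul_neg, inv_mul_cancel_left₀ h5, neg_neg]⟩
    · push Not at hA
      obtain ⟨q, hq, hq'⟩ := hA
      by_cases e1 : q.2 = c
      · right; left; left; exact ⟨q, hq, e1⟩
      · right; left; right; exact ⟨q, hq, by rw [hq' e1, neg_neg]⟩
  have := Finset.card_le_card hsub
  rw [Finset.card_univ, ZMod.card] at this
  omega

/-- **`Γ₋₈ ≡ 0`** for a `4`-element coordinate multiset with the relations, `p ≥ 19`. [folklore] -/
private theorem rels0_of_rels (hp : p.Prime) (h19 : 19 ≤ p) {T : Multiset (ZMod 40 × ZMod p)} (hT : card T = 4)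
    (hR : Rels T) : Rels0 T := by
  obtain ⟨c₀, hc₀, hA, hB⟩ := exists_free hp h19 T hT
  have hg : cG8 T c₀ = 0 := by simp only [cG8, cG8a, cG8c, oc_eq_zero_of_free hA, oc_eq_zero_of_free hB]; ring
  exact ⟨hR.zr, hR.zi, hR.e8, fun c hc ↦ by rw [hR.g8 c c₀ hc hc₀, hg]⟩

/-! ### Evaluating the functionals on explicit multisets: member contributions -/

/-- `o` of the empty multiset. [folklore] -/
private theorem oc_zero (q : ZMod 40 × ZMod p) : oc (0 : Multiset (ZMod 40 × ZMod p)) q = 0 := by simp [oc]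

/-- `o` of `a ::ₘ T`. [folklore] -/
private theorem oc_cons (a : ZMod 40 × ZMod p) (T : Multiset (ZMod 40 × ZMod p)) (q : ZMod 40 × ZMod p) :
    oc (a ::ₘ T) q = oc T q + ((if q = a then 1 else 0) - (if -q = a then 1 else 0)) := by
  simp only [oc, Multiset.count_cons, Nat.cast_add, Nat.cast_ite, Nat.cast_one, Nat.cast_zero]
  ring

/-- The contribution of a member `(f, d)` to `Z_R(b)` (even brackets). [folklore] -/
private theorem cZR_cons (f : ZMod 40) (d : ZMod p) (T : Multiset (ZMod 40 × ZMod p)) (b : ZMod p) :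
    cZR ((f, d) ::ₘ T) b = cZR T b + tZR f * ((if b = d then 1 else 0) - (if -b = d then 1 else 0)) := by
  simp only [cZR, oc_cons, Prod.mk.injEq, Prod.neg_mk]
  fin_cases f <;> simp +decide [tZR] <;> split_ifs <;> omega

/-- The contribution of a member `(f, d)` to `Z_I(b)` (even brackets). [folklore] -/
private theorem cZI_cons (f : ZMod 40) (d : ZMod p) (T : Multiset (ZMod 40 × ZMod p)) (b : ZMod p) :
    cZI ((f, d) ::ₘ T) b = cZI T b + tZI f * ((if b = d then 1 else 0) - (if -b = d then 1 else 0)) := by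
  simp only [cZI, oc_cons, Prod.mk.injEq, Prod.neg_mk]
  fin_cases f <;> simp +decide [tZI] <;> split_ifs <;> omega

/-- The contribution of a member `(f, d)` to `E₈ᵘ(b)`. [folklore] -/
private theorem cE8a_cons (f : ZMod 40) (d : ZMod p) (T : Multiset (ZMod 40 × ZMod p)) (b : ZMod p) :
    cE8a ((f, d) ::ₘ T) b = cE8a T b + tE8u f * ((if b = d then 1 else 0) - (if -b = d then 1 else 0)) := by
  simp only [cE8a, oc_cons, Prod.mk.injEq, Prod.neg_mk]
  fin_cases f <;> simp +decide [tE8u] <;> split_ifs <;> omega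

/-- The contribution of a member `(f, d)` to `E₈ᶠ(b)`. [folklore] -/
private theorem cE8c_cons (f : ZMod 40) (d : ZMod p) (T : Multiset (ZMod 40 × ZMod p)) (b : ZMod p) :
    cE8c ((f, d) ::ₘ T) b = cE8c T b + tE8c f * ((if b = d then 1 else 0) - (if -b = d then 1 else 0)) := by
  simp only [cE8c, oc_cons, Prod.mk.injEq, Prod.neg_mk]
  fin_cases f <;> simp +decide [tE8c] <;> split_ifs <;> omega

/-- The contribution of a member `(f, d)` to `E₈(b)` (even brackets at `b` and `5b`). [folklore] -/
private theorem cE8_cons (f : ZMod 40) (d : ZMod p) (T : Multiset (ZMod 40 × ZMod p)) (b : ZMod p) :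
    cE8 ((f, d) ::ₘ T) b = cE8 T b + tE8u f * ((if b = d then 1 else 0) - (if -b = d then 1 else 0)) +
      tE8f f * ((if 5 * b = d then 1 else 0) - (if -(5 * b) = d then 1 else 0)) := by
  simp only [cE8, cE8a_cons, cE8c_cons, tE8f_eq]
  ring

/-- The contribution of a member `(f, d)` to `Γ₋₈ᵘ(b)`. [folklore] -/
private theorem cG8a_cons (f : ZMod 40) (d : ZMod p) (T : Multiset (ZMod 40 × ZMod p)) (b : ZMod p) :
    cG8a ((f, d) ::ₘ T) b = cG8a T b + tG8u f * ((if b = d then 1 else 0) + (if -b = d then 1 else 0)) := by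
  simp only [cG8a, oc_cons, Prod.mk.injEq, Prod.neg_mk]
  fin_cases f <;> simp +decide [tG8u] <;> split_ifs <;> omega

/-- The contribution of a member `(f, d)` to `Γ₋₈ᶠ(b)`. [folklore] -/
private theorem cG8c_cons (f : ZMod 40) (d : ZMod p) (T : Multiset (ZMod 40 × ZMod p)) (b : ZMod p) :
    cG8c ((f, d) ::ₘ T) b = cG8c T b + tG8c f * ((if b = d then 1 else 0) + (if -b = d then 1 else 0)) := by
  simp only [cG8c, oc_cons, Prod.mk.injEq, Prod.neg_mk]
  fin_cases f <;> simp +decide [tG8c] <;> split_ifs <;> omega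

/-- The contribution of a member `(f, d)` to `Γ₋₈(b)` (odd brackets at `b` and `5b`). [folklore] -/
private theorem cG8_cons (f : ZMod 40) (d : ZMod p) (T : Multiset (ZMod 40 × ZMod p)) (b : ZMod p) :
    cG8 ((f, d) ::ₘ T) b = cG8 T b + tG8u f * ((if b = d then 1 else 0) + (if -b = d then 1 else 0)) +
      tG8f f * ((if 5 * b = d then 1 else 0) + (if -(5 * b) = d then 1 else 0)) := by
  simp only [cG8, cG8a_cons, cG8c_cons, tG8f_eq]
  ring

/-- `cZR` of the empty multiset. [folklore] -/
private theorem cZR_zero (b : ZMod p) : cZR (0 : Multiset (ZMod 40 × ZMod p)) b = 0 := by simp [cZR, oc_zero]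

/-- `cZI` of the empty multiset. [folklore] -/
private theorem cZI_zero (b : ZMod p) : cZI (0 : Multiset (ZMod 40 × ZMod p)) b = 0 := by simp [cZI, oc_zero]

/-- `cE8` of the empty multiset. [folklore] -/
private theorem cE8_zero (b : ZMod p) : cE8 (0 : Multiset (ZMod 40 × ZMod p)) b = 0 := by simp [cE8, cE8a, cE8c, oc_zero]

/-- `cG8` of the empty multiset. [folklore] -/
private theorem cG8_zero (b : ZMod p) : cG8 (0 : Multiset (ZMod 40 × ZMod p)) b = 0 := by simp [cG8, cG8a, cG8c, oc_zero]

/-- `cZR` of a singleton. [folklore] -/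
private theorem cZR_singleton (f : ZMod 40) (d : ZMod p) (b : ZMod p) :
    cZR ({(f, d)} : Multiset (ZMod 40 × ZMod p)) b = tZR f * ((if b = d then 1 else 0) - (if -b = d then 1 else 0)) := by
  rw [← Multiset.cons_zero, cZR_cons, cZR_zero, zero_add]

/-- `cZI` of a singleton. [folklore] -/
private theorem cZI_singleton (f : ZMod 40) (d : ZMod p) (b : ZMod p) :
    cZI ({(f, d)} : Multiset (ZMod 40 × ZMod p)) b = tZI f * ((if b = d then 1 else 0) - (if -b = d then 1 else 0)) := by
  rw [← Multiset.cons_zero, cZI_cons, cZI_zero, zero_add]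

/-- `cE8` of a singleton. [folklore] -/
private theorem cE8_singleton (f : ZMod 40) (d : ZMod p) (b : ZMod p) :
    cE8 ({(f, d)} : Multiset (ZMod 40 × ZMod p)) b = tE8u f * ((if b = d then 1 else 0) - (if -b = d then 1 else 0)) +
      tE8f f * ((if 5 * b = d then 1 else 0) - (if -(5 * b) = d then 1 else 0)) := by
  rw [← Multiset.cons_zero, cE8_cons, cE8_zero, zero_add]

/-- `cG8` of a singleton. [folklore] -/
private theorem cG8_singleton (f : ZMod 40) (d : ZMod p) (b : ZMod p) :
    cG8 ({(f, d)} : Multiset (ZMod 40 × ZMod p)) b = tG8u f * ((if b = d then 1 else 0) + (if -b = d then 1 else 0)) +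
      tG8f f * ((if 5 * b = d then 1 else 0) + (if -(5 * b) = d then 1 else 0)) := by
  rw [← Multiset.cons_zero, cG8_cons, cG8_zero, zero_add]

/-! ### Finite facts about the tables mod `40` -/

/-- A bracket sum `[A] + [B]` is `0`, `1` or `2`. [folklore] -/
private theorem bracket_add_cases (A B : Prop) [Decidable A] [Decidable B] :
    ((if A then (1 : ℤ) else 0) + (if B then 1 else 0)) = 0 ∨ ((if A then (1 : ℤ) else 0) + (if B then 1 else 0)) = 1 ∨
      ((if A then (1 : ℤ) else 0) + (if B then 1 else 0)) = 2 := by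
  by_cases hA : A <;> by_cases hB : B <;> simp [hA, hB]

/-- Reflected brackets, even type: `[b = −d] − [−b = −d] = −([b = d] − [−b = d])`. [folklore] -/
private theorem brkE (b d : ZMod p) :
    ((if b = -d then (1 : ℤ) else 0) - (if -b = -d then 1 else 0)) = -((if b = d then 1 else 0) - (if -b = d then 1 else 0)) := by
  have e1 : (b = -d) = (-b = d) := propext ⟨fun h ↦ by rw [h, neg_neg], fun h ↦ by rw [← h, neg_neg]⟩
  have e2 : (-b = -d) = (b = d) := propext neg_inj
  simp only [e1, e2]; ring

/-- Reflected brackets, odd type: `[b = −d] + [−b = −d] = [b = d] + [−b = d]`. [folklore] -/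
private theorem brkO (b d : ZMod p) :
    ((if b = -d then (1 : ℤ) else 0) + (if -b = -d then 1 else 0)) = ((if b = d then 1 else 0) + (if -b = d then 1 else 0)) := by
  have e1 : (b = -d) = (-b = d) := propext ⟨fun h ↦ by rw [h, neg_neg], fun h ↦ by rw [← h, neg_neg]⟩
  have e2 : (-b = -d) = (b = d) := propext neg_inj
  simp only [e1, e2]; ring

/-- Table (generic fibre): for odd `e` invisible to `Z_R`, `Z_I` (so `e ∈ {5, 15, 25, 35}`) the weight `4·(±1)` of `Γ₋₈` at the
fibre `5d = c` is not cancelled by one unit member. [folklore] -/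
private theorem tab_gen {e e' : ZMod 40} (he : e.val % 2 = 1) (h1 : tZR e = 0) (h3 : tZI e = 0) :
    tG8f e + tG8u e' * 0 ≠ 0 ∧ tG8f e + tG8u e' * 1 ≠ 0 ∧ tG8f e + tG8u e' * 2 ≠ 0 := by
  revert e e' he h1 h3; decide

/-- Table (same fibre): the relations for two odd members `(e, c), (e′, c)` force `e′ = e + 20`. [folklore] -/
private theorem tab_shift {e e' : ZMod 40} (he : e.val % 2 = 1) (he' : e'.val % 2 = 1) (h1 : tZR e + tZR e' = 0)
    (h3 : tZI e + tZI e' = 0) (hu : tE8u e + tE8u e' = 0) (hf : tE8f e + tE8f e' = 0) (hv : tG8u e + tG8u e' = 0)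
    (hg : tG8f e + tG8f e' = 0) : e' = e + 20 := by
  revert e e' he he' h1 h3 hu hf hv hg; decide

/-- Table (opposite fibres): the relations for two odd members `(e, c), (e′, −c)` force `e′ = −e`. [folklore] -/
private theorem tab_neg {e e' : ZMod 40} (he : e.val % 2 = 1) (he' : e'.val % 2 = 1) (h1 : tZR e = tZR e')
    (h3 : tZI e = tZI e') (hu : tE8u e = tE8u e') (hf : tE8f e = tE8f e') (hv : tG8u e + tG8u e' = 0)
    (hg : tG8f e + tG8f e' = 0) : e' = -e := by
  revert e e' he he' h1 h3 hu hf hv hg; decide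

/-- Table (reflection `f ↦ 20 − f` of an odd residue): the even-type tables change sign, the odd-type ones do not. [folklore] -/
private theorem tab_reflect {f : ZMod 40} (hf : f.val % 2 = 1) :
    tZR (20 - f) = -tZR f ∧ tZI (20 - f) = -tZI f ∧ tE8u (20 - f) = -tE8u f ∧ tE8f (20 - f) = -tE8f f ∧
      tG8u (20 - f) = tG8u f ∧ tG8f (20 - f) = tG8f f := by
  revert f hf; decide

/-- The tables vanish on an even residue. [folklore] -/
private theorem even_tables {f : ZMod 40} (hf : f.val % 2 = 0) :
    tZR f = 0 ∧ tZI f = 0 ∧ tE8u f = 0 ∧ tE8f f = 0 ∧ tG8u f = 0 ∧ tG8f f = 0 := by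
  revert f hf; decide

/-- Even members are invisible to the four relations. [folklore] -/
private theorem Rels0.of_cons_even {q : ZMod 40 × ZMod p} {T : Multiset (ZMod 40 × ZMod p)} (h : Rels0 (q ::ₘ T))
    (hq : q.1.val % 2 = 0) : Rels0 T := by
  obtain ⟨f, d⟩ := q
  obtain ⟨h1, h3, hu, hf, hv, hg⟩ := even_tables (f := f) hq
  refine ⟨fun b hb ↦ ?_, fun b hb ↦ ?_, fun b hb ↦ ?_, fun b hb ↦ ?_⟩
  · have := h.zr b hb
    rw [cZR_cons, h1, zero_mul, add_zero] at this
    exact this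
  · have := h.zi b hb
    rw [cZI_cons, h3, zero_mul, add_zero] at this
    exact this
  · have := h.e8 b hb
    rw [cE8_cons, hu, hf, zero_mul, zero_mul, add_zero, add_zero] at this
    exact this
  · have := h.g8 b hb
    rw [cG8_cons, hv, hg, zero_mul, zero_mul, add_zero, add_zero] at this
    exact this

/-! ### Two odd members: the shift `x ↦ x + 20p` -/

/-- **Periodicity for a two-element odd configuration.** If `O = {x, y}` (both odd) satisfies `Z_R = Z_I = E₈ = Γ₋₈ = 0`,
`x = (e, c)` with `c ≠ 0` and `y ≠ −x`, then `y = (e + 20, c)` (`= x + 20p` in `ℤ/40p`). Instances used: `Z_R`, `Z_I`, `E₈`, `Γ₋₈`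
at `c` (fibres `±c, ±5c`) and `E₈`, `Γ₋₈` at `d = c/5` (fibres `±d, ±c`); the fibre of `y` is `c`, `−c` or generic. [folklore] -/
private theorem two_odd_core (hp : p.Prime) (h19 : 19 ≤ p) {O : Multiset (ZMod 40 × ZMod p)} (hO : Rels0 O)
    {e e' : ZMod 40} {c c' : ZMod p} (hOe : O = {(e, c), (e', c')}) (he : e.val % 2 = 1) (he' : e'.val % 2 = 1) (hc : c ≠ 0)
    (hyx : ((e', c') : ZMod 40 × ZMod p) ≠ -(e, c)) : e' = e + 20 ∧ c' = c := by
  haveI := Fact.mk hp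
  have h5 : (5 : ZMod p) ≠ 0 := by exact_mod_cast natCast_ne_zero_of_lt (p := p) (n := 5) (by norm_num) (by omega)
  have h2c : (2 : ZMod p) * c ≠ 0 := by exact_mod_cast mul_ne_zero_of_lt hp hc (n := 2) (by norm_num) (by omega)
  have h4c : (4 : ZMod p) * c ≠ 0 := by exact_mod_cast mul_ne_zero_of_lt hp hc (n := 4) (by norm_num) (by omega)
  have h6c : (6 : ZMod p) * c ≠ 0 := by exact_mod_cast mul_ne_zero_of_lt hp hc (n := 6) (by norm_num) (by omega)
  -- `d` with `5d = c`
  set d : ZMod p := (5 : ZMod p)⁻¹ * c with hd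
  have h5d : 5 * d = c := by rw [hd, ← mul_assoc, mul_inv_cancel₀ h5, one_mul]
  have hd0 : d ≠ 0 := fun h0 ↦ hc (by rw [← h5d, h0, mul_zero])
  have h4d : (4 : ZMod p) * d ≠ 0 := by exact_mod_cast mul_ne_zero_of_lt hp hd0 (n := 4) (by norm_num) (by omega)
  have h6d : (6 : ZMod p) * d ≠ 0 := by exact_mod_cast mul_ne_zero_of_lt hp hd0 (n := 6) (by norm_num) (by omega)
  -- non-coincidences of the fibres `c, −c, d, −d, 5c, −5c`
  have hcc : -c ≠ c := fun h ↦ h2c (by linear_combination -h)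
  have hcc' : c ≠ -c := fun h ↦ h2c (by linear_combination h)
  have ndc : d ≠ c := fun h ↦ h4d (by linear_combination h5d - h)
  have nmdc : -d ≠ c := fun h ↦ h6d (by linear_combination h5d - h)
  have ndmc : d ≠ -c := fun h ↦ h6d (by linear_combination h5d + h)
  have nmdmc : -d ≠ -c := fun h ↦ ndc (neg_inj.mp h)
  have n5dmc : -(5 * d) ≠ c := by rw [h5d]; exact hcc
  have n5c : 5 * c ≠ c := fun h ↦ h4c (by linear_combination h)
  have nm5c : -(5 * c) ≠ c := fun h ↦ h6c (by linear_combination -h)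
  have n5cm : 5 * c ≠ -c := fun h ↦ h6c (by linear_combination h)
  have nm5cm : -(5 * c) ≠ -c := fun h ↦ n5c (neg_inj.mp h)
  -- expansions on `O = {(e,c), (e',c')}`
  have EZR : ∀ b, cZR O b = tZR e * ((if b = c then 1 else 0) - (if -b = c then 1 else 0)) +
      tZR e' * ((if b = c' then 1 else 0) - (if -b = c' then 1 else 0)) := fun b ↦ by
    rw [hOe, Multiset.insert_eq_cons, cZR_cons, cZR_singleton]; ring
  have EZI : ∀ b, cZI O b = tZI e * ((if b = c then 1 else 0) - (if -b = c then 1 else 0)) +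
      tZI e' * ((if b = c' then 1 else 0) - (if -b = c' then 1 else 0)) := fun b ↦ by
    rw [hOe, Multiset.insert_eq_cons, cZI_cons, cZI_singleton]; ring
  have EE8 : ∀ b, cE8 O b = tE8u e * ((if b = c then 1 else 0) - (if -b = c then 1 else 0)) +
      tE8f e * ((if 5 * b = c then 1 else 0) - (if -(5 * b) = c then 1 else 0)) +
      (tE8u e' * ((if b = c' then 1 else 0) - (if -b = c' then 1 else 0)) +
      tE8f e' * ((if 5 * b = c' then 1 else 0) - (if -(5 * b) = c' then 1 else 0))) := fun b ↦ by
    rw [hOe, Multiset.insert_eq_cons, cE8_cons, cE8_singleton]; ring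
  have EG8 : ∀ b, cG8 O b = tG8u e * ((if b = c then 1 else 0) + (if -b = c then 1 else 0)) +
      tG8f e * ((if 5 * b = c then 1 else 0) + (if -(5 * b) = c then 1 else 0)) +
      (tG8u e' * ((if b = c' then 1 else 0) + (if -b = c' then 1 else 0)) +
      tG8f e' * ((if 5 * b = c' then 1 else 0) + (if -(5 * b) = c' then 1 else 0))) := fun b ↦ by
    rw [hOe, Multiset.insert_eq_cons, cG8_cons, cG8_singleton]; ring
  have hZR := hO.zr c hc
  have hZI := hO.zi c hc
  have hE := hO.e8 c hc
  have hG := hO.g8 c hc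
  have hEd := hO.e8 d hd0
  have hGd := hO.g8 d hd0
  rw [EZR] at hZR
  rw [EZI] at hZI
  rw [EE8] at hE hEd
  rw [EG8] at hG hGd
  by_cases h1 : c' = c
  · subst c'
    simp only [h5d, if_true, if_false, hcc, ndc, nmdc, n5dmc, n5c, nm5c] at hZR hZI hE hG hEd hGd
    exact ⟨tab_shift he he' (by linarith) (by linarith) (by linarith) (by linarith) (by linarith) (by linarith), rfl⟩
  by_cases h2 : c' = -c
  · subst c'
    exfalso
    simp only [h5d, if_true, if_false, hcc, hcc', ndc, nmdc, ndmc, nmdmc, n5dmc, n5c, nm5c, neg_inj] at hZR hZI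
    simp only [h5d, if_true, if_false, hcc, hcc', ndc, nmdc, ndmc, nmdmc, n5dmc, n5c, nm5c, n5cm, nm5cm, neg_inj] at hE hG hEd hGd
    have key := tab_neg he he' (by linarith) (by linarith) (by linarith) (by linarith) (by linarith) (by linarith)
    exact hyx (by rw [key, Prod.neg_mk])
  · exfalso
    have h1' : c ≠ c' := fun h ↦ h1 h.symm
    have h2' : -c ≠ c' := fun h ↦ h2 h.symm
    have h3' : -(5 * d) ≠ c' := by rw [h5d]; exact h2'
    simp only [h5d, if_true, if_false, hcc, h1', h2', h3', ndc, nmdc, n5dmc, mul_zero, add_zero, sub_zero, mul_one,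
      zero_add] at hZR hZI hGd
    obtain ⟨g0, g1, g2⟩ := tab_gen (e' := e') he hZR hZI
    rcases bracket_add_cases (d = c') (-d = c') with hb | hb | hb <;> rw [hb] at hGd
    · exact g0 (by linarith)
    · exact g1 (by linarith)
    · exact g2 (by linarith)

/-- The relations of a 'half-pair' configuration `{x, 20p − x, y, 20p − y}` (all odd) are twice those of `{x, y}`. [folklore] -/
private theorem rels0_halfpair {e f : ZMod 40} {c c' : ZMod p} (he : e.val % 2 = 1) (hf : f.val % 2 = 1)
    (hH : Rels0 ({(e, c), (20 - e, -c), (f, c'), (20 - f, -c')} : Multiset (ZMod 40 × ZMod p))) :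
    Rels0 ({(e, c), (f, c')} : Multiset (ZMod 40 × ZMod p)) := by
  obtain ⟨r1, r3, ru, rf, rv, rg⟩ := tab_reflect he
  obtain ⟨r1', r3', ru', rf', rv', rg'⟩ := tab_reflect hf
  have k1 : ∀ b, cZR ({(e, c), (20 - e, -c), (f, c'), (20 - f, -c')} : Multiset (ZMod 40 × ZMod p)) b =
      2 * cZR ({(e, c), (f, c')} : Multiset (ZMod 40 × ZMod p)) b := fun b ↦ by
    simp only [Multiset.insert_eq_cons, cZR_cons, cZR_singleton, r1, r1', brkE]; ring
  have k3 : ∀ b, cZI ({(e, c), (20 - e, -c), (f, c'), (20 - f, -c')} : Multiset (ZMod 40 × ZMod p)) b =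
      2 * cZI ({(e, c), (f, c')} : Multiset (ZMod 40 × ZMod p)) b := fun b ↦ by
    simp only [Multiset.insert_eq_cons, cZI_cons, cZI_singleton, r3, r3', brkE]; ring
  have ke : ∀ b, cE8 ({(e, c), (20 - e, -c), (f, c'), (20 - f, -c')} : Multiset (ZMod 40 × ZMod p)) b =
      2 * cE8 ({(e, c), (f, c')} : Multiset (ZMod 40 × ZMod p)) b := fun b ↦ by
    simp only [Multiset.insert_eq_cons, cE8_cons, cE8_singleton, ru, ru', rf, rf', brkE]; ring
  have kg : ∀ b, cG8 ({(e, c), (20 - e, -c), (f, c'), (20 - f, -c')} : Multiset (ZMod 40 × ZMod p)) b =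
      2 * cG8 ({(e, c), (f, c')} : Multiset (ZMod 40 × ZMod p)) b := fun b ↦ by
    simp only [Multiset.insert_eq_cons, cG8_cons, cG8_singleton, rv, rv', rg, rg', brkO]; ring
  refine ⟨fun b hb ↦ ?_, fun b hb ↦ ?_, fun b hb ↦ ?_, fun b hb ↦ ?_⟩
  · have := hH.zr b hb
    rw [k1] at this
    linarith
  · have := hH.zi b hb
    rw [k3] at this
    linarith
  · have := hH.e8 b hb
    rw [ke] at this
    linarith
  · have := hH.g8 b hb
    rw [kg] at this
    linarith

/-- **No half-pair configuration.** `{x, 20p − x, y, 20p − y}` with `x = (e, c)` odd off the fibre `0`, `y` odd, `y ≠ −x`,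
`20p − y ≠ −x`, violates the relations. [folklore] -/
private theorem halfpair_odd (hp : p.Prime) (h19 : 19 ≤ p) {e f : ZMod 40} {c c' : ZMod p} (he : e.val % 2 = 1)
    (hf : f.val % 2 = 1) (hc : c ≠ 0)
    (hH : Rels0 ({(e, c), (20 - e, -c), (f, c'), (20 - f, -c')} : Multiset (ZMod 40 × ZMod p)))
    (hz1 : ((f, c') : ZMod 40 × ZMod p) ≠ -(e, c)) (hz2 : ((20 - f, -c') : ZMod 40 × ZMod p) ≠ -(e, c)) : False := by
  obtain ⟨hfe, hcc⟩ := two_odd_core hp h19 (rels0_halfpair he hf hH) rfl he hf hc hz1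
  apply hz2
  rw [hfe, hcc, Prod.neg_mk, Prod.mk.injEq]
  exact ⟨by ring, rfl⟩


/-! ### Level `40p`: arithmetic, the transfer to level `20p`, pair removal, the doubling map -/

/-- `20p` as a residue modulo `40p` (Shioda's `m′ = m/2`). -/
local notation "K40" => (((20 * p : ℕ)) : ZMod (40 * p))

/-- `20p + 20p = 0` in `ℤ/40p`. [folklore] -/
private theorem K_add_K : K40 + K40 = 0 := by
  have h : K40 + K40 = (((40 * p : ℕ)) : ZMod (40 * p)) := by push_cast; ring
  rw [h, ZMod.natCast_self]

/-- `2 · 20p = 0`. [folklore] -/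
private theorem two_mul_K : (2 : ZMod (40 * p)) * K40 = 0 := by rw [two_mul, K_add_K]

/-- `−20p = 20p`. [folklore] -/
private theorem neg_K : -K40 = K40 := by linear_combination -(K_add_K (p := p))

/-- `⟨20p⟩ = 20p`. [folklore] -/
private theorem val_K (hp : 0 < p) : (K40).val = 20 * p := by
  rw [ZMod.val_natCast, Nat.mod_eq_of_lt (by omega)]

/-- `20p ≠ 0`. [folklore] -/
private theorem K_ne_zero (hp : 0 < p) : K40 ≠ 0 := fun h ↦ by
  have := val_K hp; rw [h, ZMod.val_zero] at this; omega

/-- `⟨x + 20p⟩`: add `20p` and reduce. [folklore] -/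
private theorem val_add_K [NeZero (40 * p)] (hp : 0 < p) (x : ZMod (40 * p)) :
    ((x + K40).val = x.val + 20 * p ∧ x.val < 20 * p) ∨ ((x + K40).val + 40 * p = x.val + 20 * p ∧ 20 * p ≤ x.val) := by
  have hq := val_K hp
  have hx := ZMod.val_lt x
  by_cases h : x.val < 20 * p
  · left
    refine ⟨?_, h⟩
    rw [ZMod.val_add_of_lt (by rw [hq]; omega), hq]
  · right
    refine ⟨?_, by omega⟩
    have := ZMod.val_add_val_of_le (a := x) (b := K40) (by rw [hq]; omega)
    rw [hq] at this
    omega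

/-- `⟨2x⟩`: double and reduce. [folklore] -/
private theorem val_two_mul [NeZero (40 * p)] (hp : 0 < p) (x : ZMod (40 * p)) :
    (((2 : ZMod (40 * p)) * x).val = 2 * x.val ∧ x.val < 20 * p) ∨
      (((2 : ZMod (40 * p)) * x).val + 40 * p = 2 * x.val ∧ 20 * p ≤ x.val) := by
  have h2 : ((2 : ZMod (40 * p))).val = 2 := by
    rw [show (2 : ZMod (40 * p)) = ((2 : ℕ) : ZMod (40 * p)) by norm_cast, ZMod.val_natCast, Nat.mod_eq_of_lt (by omega)]
  have hx := ZMod.val_lt x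
  rw [ZMod.val_mul, h2]
  by_cases h : x.val < 20 * p
  · left
    exact ⟨Nat.mod_eq_of_lt (by omega), h⟩
  · right
    refine ⟨?_, by omega⟩
    rw [Nat.mod_eq_sub_mod (by omega), Nat.mod_eq_of_lt (by omega)]
    omega

/-- `20p · x = 20p` for odd `x`, `= 0` for even `x`. [folklore] -/
private theorem K_mul [NeZero (40 * p)] (x : ZMod (40 * p)) : K40 * x = if x.val % 2 = 1 then K40 else 0 := by
  have e : x = ((x.val : ℕ) : ZMod (40 * p)) := (ZMod.natCast_zmod_val x).symm
  have hd := Nat.div_add_mod x.val 2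
  have h2 := two_mul_K (p := p)
  push_cast at h2
  split_ifs with h
  · rw [h] at hd
    conv_lhs => rw [e, ← hd]
    push_cast
    linear_combination (↑(x.val / 2) : ZMod (40 * p)) * h2
  · have h0 : x.val % 2 = 0 := by omega
    rw [h0, add_zero] at hd
    conv_lhs => rw [e, ← hd]
    push_cast
    linear_combination (↑(x.val / 2) : ZMod (40 * p)) * h2

/-- A unit of `ℤ/40p` is odd. [folklore] -/
private theorem odd_of_isUnit {u : ZMod (40 * p)} (hu : IsUnit u) : u.val % 2 = 1 := by
  obtain ⟨u, rfl⟩ := hu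
  have hc := ZMod.val_coe_unit_coprime u
  by_contra h
  have h2 : 2 ∣ (u : ZMod (40 * p)).val := Nat.dvd_of_mod_eq_zero (by omega)
  have : 2 ∣ Nat.gcd (u : ZMod (40 * p)).val (40 * p) := Nat.dvd_gcd h2 ⟨20 * p, by omega⟩
  rw [hc] at this
  omega

/-- `1 + 20p` is a unit (an involution). [folklore] -/
private theorem isUnit_one_add_K : IsUnit (1 + K40 : ZMod (40 * p)) := by
  have hq2 : (K40 : ZMod (40 * p)) * K40 = 0 := by
    have : (K40 : ZMod (40 * p)) * K40 = ((10 * p : ℕ) : ZMod (40 * p)) * (((40 * p : ℕ)) : ZMod (40 * p)) := by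
      push_cast; ring
    rw [this, ZMod.natCast_self, mul_zero]
  have h1 : (1 + K40 : ZMod (40 * p)) * (1 + K40) = 1 := by linear_combination hq2 + two_mul_K (p := p)
  exact ⟨⟨1 + K40, 1 + K40, h1, h1⟩, rfl⟩

/-- Half the representative: `⟨w⟩/2` as a residue (used for even `w`). [folklore] -/
private def half (w : ZMod (40 * p)) : ZMod (40 * p) := ((w.val / 2 : ℕ) : ZMod (40 * p))

/-- `2 · (⟨w⟩/2) = w` for even `w`. [folklore] -/
private theorem two_mul_half [NeZero (40 * p)] {w : ZMod (40 * p)} (hw : w.val % 2 = 0) : (2 : ZMod (40 * p)) * half w = w := by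
  have h := Nat.div_add_mod w.val 2
  rw [hw, add_zero] at h
  have e : (((2 * (w.val / 2) : ℕ)) : ZMod (40 * p)) = w := by rw [h, ZMod.natCast_zmod_val]
  calc (2 : ZMod (40 * p)) * half w = (((2 * (w.val / 2) : ℕ)) : ZMod (40 * p)) := by unfold half; push_cast; ring
    _ = w := e

/-- `⟨w⟩/2 + ⟨w⟩/2 = w` for even `w`. [folklore] -/
private theorem half_add_half [NeZero (40 * p)] {w : ZMod (40 * p)} (hw : w.val % 2 = 0) : half w + half w = w := by
  rw [← two_mul, two_mul_half hw]

/-- The norm sum of a mapped multiset as a sum of representatives. [folklore] -/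
private theorem mNormSum_map {X : Type*} (t : Multiset X) {k : ℕ} (g : X → ZMod k) :
    mNormSum (t.map g) = (t.map fun w ↦ (g w).val).sum := by
  simp only [mNormSum, Multiset.map_map, Function.comp_def]

/-- The representative of the reduction modulo `20p`. [folklore] -/
private theorem val_castHom [NeZero (40 * p)] (hnm : 20 * p ∣ 40 * p) (y : ZMod (40 * p)) :
    (ZMod.castHom hnm (ZMod (20 * p)) y).val = y.val % (20 * p) := by
  rw [ZMod.castHom_apply, ZMod.cast_eq_val, ZMod.val_natCast]

/-- **`⟨y⟩ + ⟨y + 20p⟩ = 2⟨ȳ⟩ + 20p`** (`ȳ = y mod 20p`). [folklore] -/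
private theorem val_add_val_add_K [NeZero (40 * p)] (hp : 0 < p) (hnm : 20 * p ∣ 40 * p) (y : ZMod (40 * p)) :
    y.val + (y + K40).val = 2 * (ZMod.castHom hnm (ZMod (20 * p)) y).val + 20 * p := by
  rw [val_castHom]
  rcases val_add_K hp y with ⟨h, hlt⟩ | ⟨h, hle⟩
  · rw [Nat.mod_eq_of_lt hlt]; omega
  · rw [Nat.mod_eq_sub_mod hle, Nat.mod_eq_of_lt (by have := ZMod.val_lt y; omega)]; omega

/-- **`⟨2y⟩ = 2⟨ȳ⟩`**. [folklore] -/
private theorem val_two_mul_eq [NeZero (40 * p)] (hp : 0 < p) (hnm : 20 * p ∣ 40 * p) (y : ZMod (40 * p)) :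
    ((2 : ZMod (40 * p)) * y).val = 2 * (ZMod.castHom hnm (ZMod (20 * p)) y).val := by
  rw [val_castHom]
  rcases val_two_mul hp y with ⟨h, hlt⟩ | ⟨h, hle⟩
  · rw [Nat.mod_eq_of_lt hlt]; omega
  · rw [Nat.mod_eq_sub_mod hle, Nat.mod_eq_of_lt (by have := ZMod.val_lt y; omega)]; omega

/-- The reduction of an odd residue is non-zero. [folklore] -/
private theorem castHom_ne_zero_of_odd [NeZero (40 * p)] (hnm : 20 * p ∣ 40 * p) {w : ZMod (40 * p)} (hw : w.val % 2 = 1) :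
    ZMod.castHom hnm (ZMod (20 * p)) w ≠ 0 := by
  intro h
  have hv := congrArg ZMod.val h
  rw [val_castHom, ZMod.val_zero] at hv
  obtain ⟨k, hk⟩ := Nat.dvd_of_mod_eq_zero hv
  have : 2 ∣ w.val := ⟨10 * p * k, by rw [hk]; ring⟩
  omega

/-- The reduction of half a non-zero even residue is non-zero. [folklore] -/
private theorem castHom_half_ne_zero [NeZero (40 * p)] (hnm : 20 * p ∣ 40 * p) {w : ZMod (40 * p)} (hw0 : w ≠ 0)
    (hw : w.val % 2 = 0) : ZMod.castHom hnm (ZMod (20 * p)) (half w) ≠ 0 := by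
  intro h
  have hv := congrArg ZMod.val h
  rw [val_castHom, ZMod.val_zero, half, ZMod.val_natCast, Nat.mod_mod_of_dvd _ ⟨2, by ring⟩] at hv
  have hlt := ZMod.val_lt w
  have hdvd : 20 * p ∣ w.val / 2 := Nat.dvd_of_mod_eq_zero hv
  have h0' : w.val / 2 = 0 := Nat.eq_zero_of_dvd_of_lt hdvd (by omega)
  have h0 : w.val = 0 := by omega
  exact hw0 ((ZMod.val_eq_zero w).mp h0)

/-- The image of a unit under `unitsMap` is its reduction. [folklore] -/
private theorem coe_unitsMap (hnm : 20 * p ∣ 40 * p) (u : (ZMod (40 * p))ˣ) :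
    ((ZMod.unitsMap hnm u : (ZMod (20 * p))ˣ) : ZMod (20 * p)) = ZMod.castHom hnm (ZMod (20 * p)) (u : ZMod (40 * p)) := by
  simp [ZMod.unitsMap_def]

/-- **The transfer of a Hodge multiset of level `40p` is a Hodge multiset of level `20p`.** Split a multiset over `ℤ/40p` into
its odd part `s₁` and its even part `s₀`; then `T(s) = (s₁ mod 20p) + 2·((s₀/2) mod 20p)` (halve the even members, reduce
everything modulo `20p`, count the halved members twice) is a Hodge multiset over `ℤ/20p` whenever `s₁ + s₀` is one over `ℤ/40p`.
PROOF: for a unit `u` of `ℤ/40p` also `u(1 + 20p)` is a unit, and `u(1 + 20p)w = uw + 20p` for odd `w`, `= uw` for even `w`;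
adding the two norm equations and using `⟨y⟩ + ⟨y + 20p⟩ = 2⟨ȳ⟩ + 20p`, `⟨2y⟩ = 2⟨ȳ⟩` gives the norm equation of `T(s)` at `ū`;
every unit of `ℤ/20p` is such a `ū` (verbatim the argument of `isHodgeMultiset_transfer_twentyPrime`; the level-free form is the
tree's `FermatCharacter.isHodgeMultiset_transfer_two`). [cite: Aoki1983, Prop. 2.2] [cite: Shioda1979PJA, §1 eq. (2)] -/
theorem isHodgeMultiset_transfer_fortyPrime [NeZero (40 * p)] (hp : 0 < p) (hnm : 20 * p ∣ 40 * p)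
    {so se : Multiset (ZMod (40 * p))} (hso : ∀ w ∈ so, w.val % 2 = 1) (hse : ∀ w ∈ se, w.val % 2 = 0)
    (hs : IsHodgeMultiset (so + se)) :
    IsHodgeMultiset (so.map (ZMod.castHom hnm (ZMod (20 * p))) +
      (se.map fun w ↦ ZMod.castHom hnm (ZMod (20 * p)) (half w)) + se.map fun w ↦ ZMod.castHom hnm (ZMod (20 * p)) (half w)) := by
  classical
  set R := ZMod.castHom hnm (ZMod (20 * p)) with hR
  obtain ⟨⟨hne, hsum⟩, hnorm⟩ := hs
  refine ⟨⟨?_, ?_⟩, fun v ↦ ?_⟩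
  · intro a ha
    rcases Multiset.mem_add.mp ha with ha | ha
    · rcases Multiset.mem_add.mp ha with ha | ha
      · obtain ⟨w, hw, rfl⟩ := Multiset.mem_map.mp ha
        exact castHom_ne_zero_of_odd hnm (hso w hw)
      · obtain ⟨w, hw, rfl⟩ := Multiset.mem_map.mp ha
        exact castHom_half_ne_zero hnm (hne w (Multiset.mem_add.mpr (Or.inr hw))) (hse w hw)
    · obtain ⟨w, hw, rfl⟩ := Multiset.mem_map.mp ha
      exact castHom_half_ne_zero hnm (hne w (Multiset.mem_add.mpr (Or.inr hw))) (hse w hw)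
  · have h1 : (so.map R).sum = R so.sum := (map_multiset_sum R so).symm
    have h2 : (se.map fun w ↦ R (half w)).sum + (se.map fun w ↦ R (half w)).sum = R se.sum := by
      rw [← Multiset.sum_map_add, map_multiset_sum]
      congr 1
      refine Multiset.map_congr rfl fun w hw ↦ ?_
      rw [← RingHom.map_add, half_add_half (hse w hw)]
    rw [Multiset.sum_add, Multiset.sum_add, add_assoc, h1, h2, ← RingHom.map_add, ← Multiset.sum_add, hsum, RingHom.map_zero]
  · obtain ⟨u, hu⟩ := ZMod.unitsMap_surjective hnm v
    have hvu : (v : ZMod (20 * p)) = R u := by rw [← hu, coe_unitsMap]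
    obtain ⟨w1, hw1⟩ := isUnit_one_add_K (p := p)
    have odd_u : (u : ZMod (40 * p)).val % 2 = 1 := odd_of_isUnit u.isUnit
    have hqu : K40 * (u : ZMod (40 * p)) = K40 := by rw [K_mul, if_pos odd_u]
    have h1 := hnorm u
    have h2 := hnorm (u * w1)
    rw [Multiset.map_add, mNormSum_add, mNormSum_map, mNormSum_map, Multiset.card_add] at h1 h2
    have eso : (so.map fun w ↦ (((u * w1 : (ZMod (40 * p))ˣ) : ZMod (40 * p)) * w).val) =
        so.map fun w ↦ ((u : ZMod (40 * p)) * w + K40).val := by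
      refine Multiset.map_congr rfl fun w hw ↦ ?_
      have hqw : K40 * w = K40 := by rw [K_mul, if_pos (hso w hw)]
      rw [Units.val_mul, hw1]
      congr 1
      linear_combination (u : ZMod (40 * p)) * hqw + hqu
    have ese : (se.map fun w ↦ (((u * w1 : (ZMod (40 * p))ˣ) : ZMod (40 * p)) * w).val) =
        se.map fun w ↦ ((u : ZMod (40 * p)) * w).val := by
      refine Multiset.map_congr rfl fun w hw ↦ ?_
      have hqw : K40 * w = 0 := by rw [K_mul, if_neg (by rw [hse w hw]; omega)]
      rw [Units.val_mul, hw1]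
      congr 1
      linear_combination (u : ZMod (40 * p)) * hqw
    rw [eso, ese] at h2
    have hO : (so.map fun w ↦ ((u : ZMod (40 * p)) * w).val).sum + (so.map fun w ↦ ((u : ZMod (40 * p)) * w + K40).val).sum =
        2 * (so.map fun w ↦ (R ((u : ZMod (40 * p)) * w)).val).sum + 20 * p * Multiset.card so := by
      rw [← Multiset.sum_map_add]
      have : (so.map fun w ↦ ((u : ZMod (40 * p)) * w).val + ((u : ZMod (40 * p)) * w + K40).val) =
          so.map fun w ↦ 2 * (R ((u : ZMod (40 * p)) * w)).val + 20 * p :=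
        Multiset.map_congr rfl fun w _ ↦ val_add_val_add_K hp hnm _
      rw [this, Multiset.sum_map_add, Multiset.sum_map_mul_left, Multiset.map_const', Multiset.sum_replicate, smul_eq_mul,
        mul_comm (Multiset.card so)]
    have hE : (se.map fun w ↦ ((u : ZMod (40 * p)) * w).val).sum =
        2 * (se.map fun w ↦ (R ((u : ZMod (40 * p)) * half w)).val).sum := by
      rw [← Multiset.sum_map_mul_left]
      congr 1
      refine Multiset.map_congr rfl fun w hw ↦ ?_
      rw [← val_two_mul_eq hp hnm, mul_left_comm, two_mul_half (hse w hw)]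
    simp only [Multiset.map_add, mNormSum_add, Multiset.map_map, mNormSum_map, Multiset.card_add, Multiset.card_map,
      Function.comp_apply]
    have tso : (so.map fun w ↦ ((v : ZMod (20 * p)) * R w).val) = so.map fun w ↦ (R ((u : ZMod (40 * p)) * w)).val := by
      refine Multiset.map_congr rfl fun w _ ↦ ?_
      rw [hvu, ← map_mul]
    have tse : (se.map fun w ↦ ((v : ZMod (20 * p)) * R (half w)).val) =
        se.map fun w ↦ (R ((u : ZMod (40 * p)) * half w)).val := by
      refine Multiset.map_congr rfl fun w _ ↦ ?_
      rw [hvu, ← map_mul]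
    rw [tso, tse]
    generalize Multiset.card so = cso at h1 h2 hO ⊢
    generalize Multiset.card se = cse at h1 h2 ⊢
    have hmn : 40 * p * (cso + cse) = 2 * (20 * p * cso) + 2 * (20 * p * cse) := by ring
    have hgoal : 20 * p * (cso + cse + cse) = 20 * p * cso + 2 * (20 * p * cse) := by ring
    rw [hgoal]
    omega

/-- **Pair removal.** A Hodge multiset minus a pair `{a, −a}` is a Hodge multiset (the norm of a pair is the level at every
unit). [cite: Shioda1979PJA, §1 (elements of length 1)] -/
private theorem isHodgeMultiset_of_cons_cons_neg {n : ℕ} [NeZero n] {a : ZMod n} {τ : Multiset (ZMod n)}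
    (h : IsHodgeMultiset (a ::ₘ (-a) ::ₘ τ)) : IsHodgeMultiset τ := by
  obtain ⟨⟨hne, hsum⟩, hnorm⟩ := h
  have ha : a ≠ 0 := hne a (Multiset.mem_cons_self _ _)
  refine ⟨⟨fun x hx ↦ hne x (Multiset.mem_cons_of_mem (Multiset.mem_cons_of_mem hx)), ?_⟩, fun t ↦ ?_⟩
  · simpa [Multiset.sum_cons] using hsum
  · have h := hnorm t
    simp only [Multiset.map_cons, mNormSum_cons, Multiset.card_cons] at h
    have hta : ((t : ZMod n) * a) ≠ 0 := (t.isUnit.mul_right_eq_zero).not.mpr ha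
    have hneg : ((t : ZMod n) * -a).val = n - ((t : ZMod n) * a).val := by
      rw [mul_neg, ZMod.neg_val, if_neg hta]
    have hlt := ZMod.val_lt ((t : ZMod n) * a)
    rw [hneg] at h
    have e : n * (Multiset.card τ + 1 + 1) = n * Multiset.card τ + 2 * n := by ring
    rw [e] at h
    omega

/-- **A Hodge pair sums to zero** (the congruence part of the definition). [folklore] -/
private theorem eq_neg_of_isHodgeMultiset_pair {n : ℕ} {a b : ZMod n} (h : IsHodgeMultiset ({a, b} : Multiset (ZMod n))) :
    b = -a := by
  have := h.1.2
  simp only [Multiset.insert_eq_cons, Multiset.sum_cons, Multiset.sum_singleton] at this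
  linear_combination this

/-- **Halving the multiplicities keeps the norm equations** (`T(s) = σ + σ`). [folklore] -/
private theorem norm_of_add_self {n : ℕ} {σ : Multiset (ZMod n)} (h : IsHodgeMultiset (σ + σ)) (t : (ZMod n)ˣ) :
    2 * mNormSum (σ.map fun a ↦ (t : ZMod n) * a) = n * Multiset.card σ := by
  have := h.2 t
  rw [Multiset.map_add, mNormSum_add, Multiset.card_add,
    show n * (Multiset.card σ + Multiset.card σ) = 2 * (n * Multiset.card σ) by ring] at this
  omega

/-- `10p` as a residue modulo `20p` (Shioda's `m′` of the level `20p`). -/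
local notation "L20" => (((10 * p : ℕ)) : ZMod (20 * p))

section Double

/-- The doubling map `t ↦ 2t` from `ℤ/20p` to `ℤ/40p` (on representatives). [folklore] -/
private def dbl (t : ZMod (20 * p)) : ZMod (40 * p) := ((2 * t.val : ℕ) : ZMod (40 * p))

/-- `dbl` is additive. [folklore] -/
private theorem dbl_add [NeZero (20 * p)] (a b : ZMod (20 * p)) : dbl (a + b) = dbl a + dbl b := by
  have key : ∃ k : ℕ, 2 * a.val + 2 * b.val = 2 * (a + b).val + 40 * p * k := by
    by_cases h : a.val + b.val < 20 * p
    · exact ⟨0, by rw [ZMod.val_add_of_lt h]; ring⟩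
    · refine ⟨1, ?_⟩
      have e := ZMod.val_add_val_of_le (not_lt.mp h)
      omega
  obtain ⟨k, hk⟩ := key
  have := congrArg (Nat.cast : ℕ → ZMod (40 * p)) hk
  rw [Nat.cast_add, Nat.cast_add, Nat.cast_mul ((40 * p : ℕ)), ZMod.natCast_self, zero_mul, add_zero] at this
  unfold dbl
  rw [this]

/-- `dbl 0 = 0`. [folklore] -/
private theorem dbl_zero : dbl (0 : ZMod (20 * p)) = 0 := by
  simp [dbl]

/-- `dbl (−a) = −dbl a`. [folklore] -/
private theorem dbl_neg [NeZero (20 * p)] (a : ZMod (20 * p)) : dbl (-a) = -dbl a :=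
  eq_neg_of_add_eq_zero_left (by rw [← dbl_add, neg_add_cancel, dbl_zero])

/-- `dbl (k a) = k dbl a`. [folklore] -/
private theorem dbl_natCast_mul [NeZero (20 * p)] (k : ℕ) (a : ZMod (20 * p)) :
    dbl ((k : ZMod (20 * p)) * a) = (k : ZMod (40 * p)) * dbl a := by
  induction k with
  | zero => simp [dbl_zero]
  | succ k ih => rw [Nat.cast_succ, Nat.cast_succ, add_mul, one_mul, dbl_add, ih, add_mul, one_mul]

/-- `dbl (2a) = 2 dbl a`. [folklore] -/
private theorem dbl_two_mul [NeZero (20 * p)] (a : ZMod (20 * p)) : dbl (2 * a) = 2 * dbl a := by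
  exact_mod_cast dbl_natCast_mul 2 a

/-- `dbl (4a) = 4 dbl a`. [folklore] -/
private theorem dbl_four_mul [NeZero (20 * p)] (a : ZMod (20 * p)) : dbl (4 * a) = 4 * dbl a := by
  exact_mod_cast dbl_natCast_mul 4 a

/-- `dbl (y mod 20p) = 2y`. [folklore] -/
private theorem dbl_castHom [NeZero (40 * p)] (hnm : 20 * p ∣ 40 * p) (y : ZMod (40 * p)) :
    dbl (ZMod.castHom hnm (ZMod (20 * p)) y) = 2 * y := by
  unfold dbl
  rw [val_castHom]
  have key : ∃ k : ℕ, 2 * y.val = 2 * (y.val % (20 * p)) + 40 * p * k := by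
    have hlt := ZMod.val_lt y
    by_cases h : y.val < 20 * p
    · exact ⟨0, by rw [Nat.mod_eq_of_lt h]; ring⟩
    · refine ⟨1, ?_⟩
      rw [Nat.mod_eq_sub_mod (not_lt.mp h), Nat.mod_eq_of_lt (by omega)]
      omega
  obtain ⟨k, hk⟩ := key
  have := congrArg (Nat.cast : ℕ → ZMod (40 * p)) hk
  rw [Nat.cast_add, Nat.cast_mul ((40 * p : ℕ)), ZMod.natCast_self, zero_mul, add_zero, Nat.cast_mul, Nat.cast_ofNat,
    ZMod.natCast_zmod_val] at this
  rw [← this]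

/-- `dbl ((w/2) mod 20p) = w` for even `w`. [folklore] -/
private theorem dbl_castHom_half [NeZero (40 * p)] (hnm : 20 * p ∣ 40 * p) {w : ZMod (40 * p)} (hw : w.val % 2 = 0) :
    dbl (ZMod.castHom hnm (ZMod (20 * p)) (half w)) = w := by
  rw [dbl_castHom hnm, two_mul_half hw]

/-- `⟨10p̄⟩ = 10p` at level `20p`. [folklore] -/
private theorem val_L20 (hp : 0 < p) : (L20).val = 10 * p := by
  rw [ZMod.val_natCast, Nat.mod_eq_of_lt (by omega)]

/-- `dbl 10p̄ = 20p`. [folklore] -/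
private theorem dbl_L20 (hp : 0 < p) : dbl L20 = K40 := by
  unfold dbl
  rw [val_L20 hp, show 2 * (10 * p) = 20 * p by ring]

/-- `10p̄ ≠ 0` at level `20p`. [folklore] -/
private theorem L20_ne_zero (hp : 0 < p) : L20 ≠ 0 := fun h ↦ by
  have h1 := congrArg ZMod.val h
  rw [val_L20 hp, ZMod.val_zero] at h1
  omega

/-- `−10p̄ = 10p̄` at level `20p`. [folklore] -/
private theorem neg_L20 : -L20 = L20 := by
  have h : L20 + L20 = (((20 * p : ℕ)) : ZMod (20 * p)) := by push_cast; ring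
  rw [ZMod.natCast_self] at h
  linear_combination -h

/-- `2z = 0` iff `z ∈ {0, 10p̄}` at level `20p`. [folklore] -/
private theorem two_mul_eq_zero_twentyP [NeZero (20 * p)] (hp : 0 < p) {z : ZMod (20 * p)} :
    (2 : ZMod (20 * p)) * z = 0 ↔ z = 0 ∨ z = L20 := by
  constructor
  · intro h
    have hv := congrArg ZMod.val h
    have h2 : ((2 : ZMod (20 * p))).val = 2 := by
      rw [show (2 : ZMod (20 * p)) = ((2 : ℕ) : ZMod (20 * p)) by norm_cast, ZMod.val_natCast, Nat.mod_eq_of_lt (by omega)]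
    rw [ZMod.val_mul, h2, ZMod.val_zero] at hv
    have hlt := ZMod.val_lt z
    obtain ⟨k, hk⟩ := Nat.dvd_of_mod_eq_zero hv
    have hk2 : k < 2 := by
      by_contra hk2
      have : 20 * p * 2 ≤ 20 * p * k := Nat.mul_le_mul_left _ (by omega)
      omega
    interval_cases k
    · left
      apply ZMod.val_injective (20 * p)
      rw [ZMod.val_zero]; omega
    · right
      apply ZMod.val_injective (20 * p)
      rw [val_L20 hp]; omega
  · rintro (rfl | rfl)
    · rw [mul_zero]
    · linear_combination -(neg_L20 (p := p))

/-- The residue of the norm sum is the sum. [folklore] -/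
private theorem natCast_mNormSum {n : ℕ} [NeZero n] (t : Multiset (ZMod n)) : ((mNormSum t : ℕ) : ZMod n) = t.sum := by
  rw [mNormSum, Nat.cast_multiset_sum, Multiset.map_map]
  have : (t.map (Nat.cast ∘ ZMod.val) : Multiset (ZMod n)) = t.map id :=
    Multiset.map_congr rfl fun a _ ↦ ZMod.natCast_zmod_val a
  rw [this, Multiset.map_id]

/-- Parity at level `20p`: the reduction keeps the parity of the representative. [folklore] -/
private theorem val_castHom_mod_two [NeZero (40 * p)] (hnm : 20 * p ∣ 40 * p) (y : ZMod (40 * p)) :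
    (ZMod.castHom hnm (ZMod (20 * p)) y).val % 2 = y.val % 2 := by
  rw [val_castHom, Nat.mod_mod_of_dvd _ (⟨10 * p, by ring⟩ : 2 ∣ 20 * p)]

/-- Parity at level `20p`: negation keeps parity. [folklore] -/
private theorem val_neg_mod_two_twenty [NeZero (20 * p)] (a : ZMod (20 * p)) : (-a).val % 2 = a.val % 2 := by
  rw [ZMod.neg_val]
  split_ifs with h
  · rw [h, ZMod.val_zero]
  · have := ZMod.val_lt a
    omega

/-- Parity at level `20p`: a `2`-multiple is even. [folklore] -/
private theorem val_two_mul_mod_two_twenty [NeZero (20 * p)] (a : ZMod (20 * p)) : ((2 : ZMod (20 * p)) * a).val % 2 = 0 := by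
  have h2 : ((2 : ZMod (20 * p))).val % 2 = 0 := by
    rw [show (2 : ZMod (20 * p)) = ((2 : ℕ) : ZMod (20 * p)) by norm_cast, ZMod.val_natCast]
    rcases Nat.lt_or_ge 2 (20 * p) with h | h
    · rw [Nat.mod_eq_of_lt h]
    · have : 20 * p = 0 ∨ 20 * p = 1 ∨ 20 * p = 2 := by omega
      rcases this with h0 | h0 | h0
      · exact absurd h0 (NeZero.ne _)
      · omega
      · rw [h0]
  rw [ZMod.val_mul, Nat.mod_mod_of_dvd _ ⟨10 * p, by ring⟩, Nat.mul_mod, h2, zero_mul, Nat.zero_mod]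

end Double

/-! ### Indices: pair-freeness of explicit quadruples -/

/-- Two distinct positions of a tuple give a member of the value multiset and a member of its erasure. [folklore] -/
private theorem apply_mem_erase_of_ne {K : ℕ} {X : Type*} [DecidableEq X] (Z : Fin K → X) {i j : Fin K} (hij : i ≠ j) :
    Z j ∈ (univ.val.map Z).erase (Z i) := by
  by_cases h : Z j = Z i
  · rw [h, ← Multiset.count_pos, Multiset.count_erase_self]
    have h2 : 2 ≤ count (Z i) (univ.val.map Z) := by
      rw [Multiset.count_map]
      have hsub : ({i, j} : Finset (Fin K)).val ≤ univ.val.filter fun k ↦ Z i = Z k := by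
        rw [Multiset.le_iff_subset (Finset.nodup _)]
        intro k hk
        rw [Finset.mem_val, Finset.mem_insert, Finset.mem_singleton] at hk
        rw [Multiset.mem_filter]
        rcases hk with rfl | rfl
        · exact ⟨Finset.mem_univ_val _, rfl⟩
        · exact ⟨Finset.mem_univ_val _, h.symm⟩
      calc 2 = Multiset.card ({i, j} : Finset (Fin K)).val := by rw [Finset.card_val, Finset.card_pair hij]
        _ ≤ _ := Multiset.card_le_card hsub
    omega
  · exact (Multiset.mem_erase_of_ne h).mpr (Multiset.mem_map.mpr ⟨j, Finset.mem_univ_val j, rfl⟩)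

/-- Indecomposability of a tuple in terms of its multiset of values. [folklore] -/
private theorem pairfree_of_fun {n : ℕ} {α : Fin 4 → ZMod n} (hind : ∀ i j : Fin 4, i ≠ j → α i + α j ≠ 0) :
    ∀ a ∈ univ.val.map α, ∀ b ∈ (univ.val.map α).erase a, a + b ≠ 0 := by
  classical
  intro a ha b hb hab
  obtain ⟨i, -, rfl⟩ := Multiset.mem_map.mp ha
  by_cases hba : b = α i
  · have h2 : 2 ≤ count (α i) (univ.val.map α) := by
      have := Multiset.count_pos.mpr (hba ▸ hb)
      rw [Multiset.count_erase_self] at this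
      omega
    rw [count_univ_val_map] at h2
    obtain ⟨j, hj, k, hk, hjk⟩ := Finset.one_lt_card.mp h2
    simp only [Finset.mem_filter, Finset.mem_univ, true_and] at hj hk
    exact hind j k hjk (by rw [hj, hk, ← hba]; nth_rw 1 [hba]; exact hab)
  · have hb' : b ∈ univ.val.map α := Multiset.mem_of_mem_erase hb
    obtain ⟨j, -, rfl⟩ := Multiset.mem_map.mp hb'
    exact hind i j (fun e ↦ hba (by rw [e])) hab

/-- The value multiset of `![a, b, c, d]`. [folklore] -/
private theorem univ_val_map_four {X : Type*} (a b c d : X) : univ.val.map ![a, b, c, d] = {a, b, c, d} := by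
  simp; rfl

/-- **Parity count.** A multiset over `ℤ/40p` with sum `0` has an even number of odd entries. [folklore] -/
private theorem even_card_filter_odd [NeZero (40 * p)] {s : Multiset (ZMod (40 * p))} (hs : s.sum = 0) :
    Even (Multiset.card (s.filter fun a ↦ a.val % 2 = 1)) := by
  have hsum : 40 * p ∣ (s.map ZMod.val).sum := by
    rw [← ZMod.natCast_eq_zero_iff, Nat.cast_multiset_sum, Multiset.map_map]
    have : (s.map (Nat.cast ∘ ZMod.val) : Multiset (ZMod (40 * p))) = s.map id :=
      Multiset.map_congr rfl fun a _ ↦ ZMod.natCast_zmod_val a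
    rw [this, Multiset.map_id, hs]
  have h2 : 2 ∣ (s.map ZMod.val).sum := Nat.dvd_trans ⟨20 * p, by ring⟩ hsum
  have key : ∀ t : Multiset (ZMod (40 * p)),
      (t.map ZMod.val).sum % 2 = Multiset.card (t.filter fun a ↦ a.val % 2 = 1) % 2 := by
    intro t
    induction t using Multiset.induction_on with
    | empty => simp
    | cons a t ih =>
      rw [Multiset.map_cons, Multiset.sum_cons, Multiset.filter_cons, Multiset.card_add, Nat.add_mod, ih]
      split_ifs with ha
      · rw [Multiset.card_singleton]
        omega
      · rw [Multiset.card_zero]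
        omega
  have := key s
  rw [Nat.even_iff]
  omega

/-! ### Small multiset and coordinate helpers -/

/-- `{a, b} + {c, d} = {a, b, c, d}`. [folklore] -/
private theorem pair_add_pair {X : Type*} (a b c d : X) : ({a, b} : Multiset X) + {c, d} = {a, b, c, d} := by
  simp only [Multiset.insert_eq_cons, Multiset.cons_add, Multiset.singleton_add]

/-- A `4`-multiset whose six pairwise sums are non-zero is pair-free. [folklore] -/
private theorem pairfree_quad {n : ℕ} {a b c d : ZMod n} (hab : a + b ≠ 0) (hac : a + c ≠ 0) (had : a + d ≠ 0)
    (hbc : b + c ≠ 0) (hbd : b + d ≠ 0) (hcd : c + d ≠ 0) :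
    ∀ u ∈ ({a, b, c, d} : Multiset (ZMod n)), ∀ v ∈ (({a, b, c, d} : Multiset (ZMod n))).erase u, u + v ≠ 0 := by
  rw [← univ_val_map_four]
  refine pairfree_of_fun fun i j hij h ↦ ?_
  fin_cases i <;> fin_cases j <;> simp at hij h <;>
    first
    | exact hab (by linear_combination h)
    | exact hac (by linear_combination h)
    | exact had (by linear_combination h)
    | exact hbc (by linear_combination h)
    | exact hbd (by linear_combination h)
    | exact hcd (by linear_combination h)

/-- The kernel of the reduction `ℤ/40p → ℤ/20p` is `{0, 20p}`. [folklore] -/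
private theorem castHom_eq_zero_iff [NeZero (40 * p)] (hp : 0 < p) (hnm : 20 * p ∣ 40 * p) {w : ZMod (40 * p)} :
    ZMod.castHom hnm (ZMod (20 * p)) w = 0 ↔ w = 0 ∨ w = K40 := by
  haveI : NeZero (20 * p) := ⟨by omega⟩
  constructor
  · intro h0
    have hv := congrArg ZMod.val h0
    rw [val_castHom, ZMod.val_zero] at hv
    have hlt := ZMod.val_lt w
    obtain ⟨k, hk⟩ := Nat.dvd_of_mod_eq_zero hv
    have hk2 : k < 2 := by
      by_contra hk2
      have : 20 * p * 2 ≤ 20 * p * k := Nat.mul_le_mul_left _ (by omega)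
      omega
    interval_cases k
    · left
      apply ZMod.val_injective (40 * p)
      rw [ZMod.val_zero]; omega
    · right
      apply ZMod.val_injective (40 * p)
      rw [val_K hp]; omega
  · rintro (rfl | rfl)
    · exact _root_.map_zero _
    · rw [map_natCast, show ((20 * p : ℕ) : ZMod (20 * p)) = 0 from ZMod.natCast_self _]

/-- Two residues with the same reduction mod `20p` differ by `0` or `20p`. [folklore] -/
private theorem lift_eq [NeZero (40 * p)] (hp : 0 < p) (hnm : 20 * p ∣ 40 * p) {a b : ZMod (40 * p)}
    (h : ZMod.castHom hnm (ZMod (20 * p)) a = ZMod.castHom hnm (ZMod (20 * p)) b) : a = b ∨ a = b + K40 := by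
  have : ZMod.castHom hnm (ZMod (20 * p)) (a - b) = 0 := by rw [_root_.map_sub, h, sub_self]
  rcases (castHom_eq_zero_iff hp hnm).mp this with e | e
  · left; linear_combination e
  · right; linear_combination e

/-! ### Lifts along `k ↦ ⟨k⟩·d : ℤ/n → ℤ/nd` (the tree's `liftBy`; API re-proved here, private in `HodgeQuadruplesTenPrime`) -/

section Lift

variable {m n d : ℕ} [NeZero m] [NeZero n]

-- BEGIN DUP (verbatim from HodgeQuadruplesThirtySixPrime.lean / HodgeQuadruplesTenPrime.lean; private there)
/-- `⟨liftBy k⟩ = ⟨k⟩ d`. [folklore] -/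
private theorem val_liftBy (hm : m = n * d) (k : ZMod n) : (liftBy m n d k).val = k.val * d := by
  rw [liftBy, ZMod.val_natCast, Nat.mod_eq_of_lt (by rw [hm]; have := ZMod.val_lt k; have := NeZero.pos m; nlinarith)]

omit [NeZero m] in
/-- `liftBy` is additive. [folklore] -/
private theorem liftBy_add (hm : m = n * d) (a b : ZMod n) : liftBy m n d (a + b) = liftBy m n d a + liftBy m n d b := by
  rw [liftBy, liftBy, liftBy, ← Nat.cast_add, ZMod.natCast_eq_natCast_iff, hm, ZMod.val_add, ← Nat.add_mul,
    ← Nat.mul_mod_mul_right]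
  exact Nat.mod_modEq _ _

omit [NeZero m] [NeZero n] in
/-- `liftBy 0 = 0`. [folklore] -/
private theorem liftBy_zero : liftBy m n d 0 = 0 := by
  simp [liftBy]

omit [NeZero n] in
/-- Every residue in `dℤ/m` is a lift. [folklore] -/
private theorem liftBy_div (hm : m = n * d) (hd : 0 < d) {w : ZMod m} (hw : d ∣ w.val) :
    liftBy m n d ((w.val / d : ℕ) : ZMod n) = w := by
  have hlt : w.val / d < n := by
    rw [Nat.div_lt_iff_lt_mul hd]; exact lt_of_lt_of_eq (ZMod.val_lt w) hm
  rw [liftBy, ZMod.val_natCast, Nat.mod_eq_of_lt hlt, Nat.div_mul_cancel hw, ZMod.natCast_zmod_val]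

/-- A multiset all of whose members lie in `dℤ/m` is a lift; the lift is pair-free if the original is. [folklore] -/
private theorem exists_eq_map_liftBy (hm : m = n * d) (hd : 0 < d) {s : Multiset (ZMod m)} (hs : ∀ w ∈ s, d ∣ w.val) :
    ∃ M : Multiset (ZMod n), s = M.map (liftBy m n d) ∧ Multiset.card M = Multiset.card s ∧
      ((∀ a ∈ s, ∀ b ∈ s.erase a, a + b ≠ 0) → ∀ a ∈ M, ∀ b ∈ M.erase a, a + b ≠ 0) := by
  classical
  set g : ZMod m → ZMod n := fun w ↦ ((w.val / d : ℕ) : ZMod n) with hg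
  have hga : ∀ w ∈ s, liftBy m n d (g w) = w := fun w hw ↦ liftBy_div hm hd (hs w hw)
  refine ⟨s.map g, ?_, by rw [Multiset.card_map], fun hpf a ha b hb hab ↦ ?_⟩
  · rw [Multiset.map_map]
    conv_lhs => rw [← Multiset.map_id s]
    exact Multiset.map_congr rfl fun w hw ↦ (hga w hw).symm
  · obtain ⟨a', ha', rfl⟩ := Multiset.mem_map.mp ha
    rw [← Multiset.map_erase_of_mem _ _ ha'] at hb
    obtain ⟨b', hb', rfl⟩ := Multiset.mem_map.mp hb
    have hb's : b' ∈ s := Multiset.mem_of_mem_erase hb'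
    apply hpf a' ha' b' hb'
    have e : liftBy m n d (g a' + g b') = 0 := by rw [hab, liftBy_zero]
    rwa [liftBy_add hm, hga a' ha', hga b' hb's] at e

omit [NeZero m] in
/-- `liftBy (−a) = −liftBy a`. [folklore] -/
private theorem liftBy_neg (hm : m = n * d) (a : ZMod n) : liftBy m n d (-a) = -liftBy m n d a :=
  eq_neg_of_add_eq_zero_left (by rw [← liftBy_add hm, neg_add_cancel, liftBy_zero])

omit [NeZero m] in
/-- `liftBy (k a) = k liftBy a`. [folklore] -/
private theorem liftBy_natCast_mul (hm : m = n * d) (k : ℕ) (a : ZMod n) :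
    liftBy m n d ((k : ZMod n) * a) = (k : ZMod m) * liftBy m n d a := by
  induction k with
  | zero => simp [liftBy_zero]
  | succ k ih => rw [Nat.cast_succ, Nat.cast_succ, add_mul, one_mul, liftBy_add hm, ih, add_mul, one_mul]

omit [NeZero m] in
/-- `liftBy (k a) = k liftBy a` for numerals. [folklore] -/
private theorem liftBy_ofNat_mul (hm : m = n * d) (k : ℕ) [k.AtLeastTwo] (a : ZMod n) :
    liftBy m n d (OfNat.ofNat k * a) = (OfNat.ofNat k : ZMod m) * liftBy m n d a := by
  exact_mod_cast liftBy_natCast_mul hm k a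

omit [NeZero m] [NeZero n] in
/-- `liftBy` of a natural-number residue. [folklore] -/
private theorem liftBy_natCast (j : ℕ) (hj : j < n) : liftBy m n d (j : ZMod n) = ((j * d : ℕ) : ZMod m) := by
  rw [liftBy, ZMod.val_natCast, Nat.mod_eq_of_lt hj]
-- END DUP

end Lift

/-! ### The conclusion of the classification -/

/-- The conclusion of the classification at level `40p` for `s`: `α_x`, `β_x`, or one of the `42` lifted non-standard quadruples of
level `40`. [folklore] -/
private def Concl (s : Multiset (ZMod (40 * p))) : Prop :=
  ∃ x : ZMod (40 * p), s = {x, x + K40, -(2 * x), K40} ∨ s = {x, x + K40, 2 * x + K40, -(4 * x)} ∨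
    ((∃ t : ℕ, (t = 1 ∨ t = 3 ∨ t = 7 ∨ t = 9 ∨ t = 11 ∨ t = 13 ∨ t = 17 ∨ t = 19 ∨ t = 21 ∨ t = 23 ∨ t = 27 ∨ t = 29 ∨ t = 31 ∨
        t = 33 ∨ t = 37 ∨ t = 39) ∧ x = ((t * p : ℕ) : ZMod (40 * p))) ∧
      (s = {x, 21 * x, 24 * x, 34 * x} ∨ s = {x, 21 * x, 26 * x, 32 * x} ∨ s = {2 * x, 8 * x, 34 * x, 36 * x} ∨
        s = {2 * x, 12 * x, 32 * x, 34 * x} ∨ s = {2 * x, 18 * x, 26 * x, 34 * x} ∨ s = {2 * x, 20 * x, 24 * x, 34 * x}))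

/-! ### Case 0: all members in the fibre `0` — the level `40` (`HodgeQuadruplesForty`) -/

/-- The units of `ℤ/40` by representative. [folklore] -/
private theorem unit_val40 {k : ZMod 40}
    (hk : k = 1 ∨ k = 3 ∨ k = 7 ∨ k = 9 ∨ k = 11 ∨ k = 13 ∨ k = 17 ∨ k = 19 ∨ k = 21 ∨ k = 23 ∨ k = 27 ∨ k = 29 ∨ k = 31 ∨ k = 33 ∨
      k = 37 ∨ k = 39) :
    k.val = 1 ∨ k.val = 3 ∨ k.val = 7 ∨ k.val = 9 ∨ k.val = 11 ∨ k.val = 13 ∨ k.val = 17 ∨ k.val = 19 ∨ k.val = 21 ∨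
      k.val = 23 ∨ k.val = 27 ∨ k.val = 29 ∨ k.val = 31 ∨ k.val = 33 ∨ k.val = 37 ∨ k.val = 39 := by
  rcases hk with rfl | rfl | rfl | rfl | rfl | rfl | rfl | rfl | rfl | rfl | rfl | rfl | rfl | rfl | rfl | rfl <;> decide

/-- **All members in `pℤ/40p`:** `s = p·M` with `M` a pair-free Hodge quadruple of level `40` (`𝔍ₘ(p) ≅ 𝔍₄₀(1)`), classified by
`classify_hodgeMultiset_forty`. [cite: Shioda1982PicardFermat, §2 p. 726 (𝔍ₘ(d) ≅ 𝔍_{m/d}(1)) and table p. 727 (m = 40)]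
[cite: MeyerNeutsch1981Fermatquadrupel, Tabelle 1 p. 54 (N = 20, 40)] -/
private theorem fibre_zero (h : Nat.Coprime 40 p) [NeZero (40 * p)] (hp : p.Prime)
    {s : Multiset (ZMod (40 * p))} (hs : IsHodgeMultiset s) (hcard : Multiset.card s = 4)
    (hind : ∀ a ∈ s, ∀ b ∈ s.erase a, a + b ≠ 0) (h0 : ∀ w ∈ s, (crt h w).2 = 0) : Concl s := by
  classical
  have hp0 := hp.pos
  have hm : 40 * p = 40 * p := rfl
  have hdiv : ∀ w ∈ s, p ∣ w.val := fun w hw ↦ by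
    have := h0 w hw
    rwa [crt_snd, ZMod.natCast_eq_zero_iff] at this
  obtain ⟨M, hsM, hcM, hpfM⟩ := exists_eq_map_liftBy (m := 40 * p) (n := 40) (d := p) hm hp0 hdiv
  rw [hcard] at hcM
  have hMH : IsHodgeMultiset M := (isHodgeMultiset_map_liftBy_iff hm hp0 M).mp (hsM ▸ hs)
  obtain ⟨k, hk⟩ := classify_hodgeMultiset_forty hMH hcM (hpfM hind)
  have ΦK : liftBy (40 * p) 40 p 20 = K40 := by
    rw [show (20 : ZMod 40) = ((20 : ℕ) : ZMod 40) from (Nat.cast_ofNat).symm, liftBy_natCast 20 (by norm_num)]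
  refine ⟨liftBy (40 * p) 40 p k, ?_⟩
  rw [hsM]
  rcases hk with e | e | ⟨hkk, e⟩
  · left
    rw [e]
    simp only [Multiset.insert_eq_cons, Multiset.map_cons, Multiset.map_singleton, liftBy_add hm, liftBy_neg hm,
      liftBy_ofNat_mul hm, ΦK]
  · right; left
    rw [e]
    simp only [Multiset.insert_eq_cons, Multiset.map_cons, Multiset.map_singleton, liftBy_add hm, liftBy_neg hm,
      liftBy_ofNat_mul hm, ΦK]
  · right; right
    refine ⟨⟨k.val, unit_val40 hkk, rfl⟩, ?_⟩
    rcases e with e | e | e | e | e | e <;> rw [e] <;>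
      simp only [Multiset.insert_eq_cons, Multiset.map_cons, Multiset.map_singleton, liftBy_ofNat_mul hm, true_or, or_true]

/-! ### Case I: all members even — the level `20p` -/

/-- **All members even:** `s = 2σ` with `σ` a pair-free Hodge `4`-multiset of level `20p` (`𝔍ₘ(2) ≅ 𝔍_{20p}(1)`), which the
level-`20p` theorem classifies (`p ≥ 19`); doubling back gives `α_x`, `β_x` with `x = 2y`, or twice a lifted exceptional quadruple of
level `20` — a lifted quadruple of level `40` of one of the last four shapes.
[cite: Shioda1982PicardFermat, §2 p. 726 (𝔍ₘ(d) ≅ 𝔍_{m/d}(1)) and Prop. 4 (Q′) p. 729] -/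
private theorem case_all_even [NeZero (40 * p)] (hp : p.Prime) (h19 : 19 ≤ p) {s : Multiset (ZMod (40 * p))}
    (hs : IsHodgeMultiset s) (hcard : Multiset.card s = 4) (hpf : ∀ a ∈ s, ∀ b ∈ s.erase a, a + b ≠ 0)
    (hev : ∀ w ∈ s, w.val % 2 = 0) : Concl s := by
  classical
  have hp0 := hp.pos
  haveI : NeZero (20 * p) := ⟨by omega⟩
  have hm : 40 * p = 20 * p * 2 := by ring
  have hdiv : ∀ w ∈ s, 2 ∣ w.val := fun w hw ↦ Nat.dvd_of_mod_eq_zero (hev w hw)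
  obtain ⟨σ, hsσ, hcσ, hpfσ⟩ := exists_eq_map_liftBy hm two_pos hdiv
  rw [hcard] at hcσ
  have hσH : IsHodgeMultiset σ := (isHodgeMultiset_map_liftBy_iff hm two_pos σ).mp (hsσ ▸ hs)
  obtain ⟨y, hy⟩ := classify_hodgeMultiset_twentyPrime hp h19 hσH hcσ (hpfσ hpf)
  have ΦK : liftBy (40 * p) (20 * p) 2 L20 = K40 := by rw [liftBy_natCast (10 * p) (by omega)]; push_cast; ring
  rw [hsσ]
  rcases hy with e | e | ⟨⟨t, ht, hty⟩, e⟩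
  · refine ⟨liftBy (40 * p) (20 * p) 2 y, Or.inl ?_⟩
    rw [e]
    simp only [Multiset.insert_eq_cons, Multiset.map_cons, Multiset.map_singleton, liftBy_add hm, liftBy_neg hm,
      liftBy_ofNat_mul hm, ΦK]
  · refine ⟨liftBy (40 * p) (20 * p) 2 y, Or.inr (Or.inl ?_)⟩
    rw [e]
    simp only [Multiset.insert_eq_cons, Multiset.map_cons, Multiset.map_singleton, liftBy_add hm, liftBy_neg hm,
      liftBy_ofNat_mul hm, ΦK]
  · -- twice a lifted exceptional quadruple of level `20`
    set x : ZMod (40 * p) := ((t * p : ℕ) : ZMod (40 * p)) with hx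
    have ht20 : t < 20 := by rcases ht with rfl | rfl | rfl | rfl | rfl | rfl | rfl | rfl <;> norm_num
    have htp : t * p < 20 * p := by nlinarith
    have hΦy : liftBy (40 * p) (20 * p) 2 y = 2 * x := by
      rw [hty, liftBy_natCast (t * p) htp, hx]; push_cast; ring
    have ht' : t = 1 ∨ t = 3 ∨ t = 7 ∨ t = 9 ∨ t = 11 ∨ t = 13 ∨ t = 17 ∨ t = 19 ∨ t = 21 ∨ t = 23 ∨ t = 27 ∨ t = 29 ∨ t = 31 ∨
        t = 33 ∨ t = 37 ∨ t = 39 := by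
      rcases ht with rfl | rfl | rfl | rfl | rfl | rfl | rfl | rfl <;> simp
    refine ⟨x, Or.inr (Or.inr ⟨⟨t, ht', hx⟩, ?_⟩)⟩
    have e4 : (4 : ZMod (40 * p)) * (2 * x) = 8 * x := by ring
    have e6 : (6 : ZMod (40 * p)) * (2 * x) = 12 * x := by ring
    have e9 : (9 : ZMod (40 * p)) * (2 * x) = 18 * x := by ring
    have e10 : (10 : ZMod (40 * p)) * (2 * x) = 20 * x := by ring
    have e12 : (12 : ZMod (40 * p)) * (2 * x) = 24 * x := by ring
    have e13 : (13 : ZMod (40 * p)) * (2 * x) = 26 * x := by ring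
    have e16 : (16 : ZMod (40 * p)) * (2 * x) = 32 * x := by ring
    have e17 : (17 : ZMod (40 * p)) * (2 * x) = 34 * x := by ring
    have e18 : (18 : ZMod (40 * p)) * (2 * x) = 36 * x := by ring
    rcases e with e | e | e | e <;> rw [e] <;>
      simp only [Multiset.insert_eq_cons, Multiset.map_cons, Multiset.map_singleton, liftBy_ofNat_mul hm, hΦy, e4, e6, e9,
        e10, e12, e13, e16, e17, e18, true_or, or_true]

/-! ### The fibre `0`: `φ`, `ψ` and the half-line table -/

/-- `φ k = pt(kπ, 0)`: the multiple `⟨k⟩·p` of `p` in `ℤ/40p`. [folklore] -/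
private def phi (h : Nat.Coprime 40 p) (k : ZMod 40) : ZMod (40 * p) := pt h (k * π) 0

/-- `φ` is additive. [folklore] -/
private theorem phi_add (h : Nat.Coprime 40 p) (a b : ZMod 40) : phi h (a + b) = phi h a + phi h b := by
  unfold phi; rw [add_mul, pt_add, add_zero]

/-- `φ(−a) = −φ a`. [folklore] -/
private theorem phi_neg (h : Nat.Coprime 40 p) (a : ZMod 40) : phi h (-a) = -phi h a := by
  unfold phi; rw [neg_pt, neg_zero, neg_mul]

/-- `φ 20 = 20p`. [folklore] -/
private theorem phi_twenty (h : Nat.Coprime 40 p) [NeZero (40 * p)] (hp : p.Prime) (h7 : 7 ≤ p) : phi h 20 = K40 := by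
  unfold phi; rw [twenty_mul_pi hp h7, twentyP_eq_pt h hp h7]

/-- `φ k = ⟨k⟩p`. [folklore] -/
private theorem phi_eq_natCast (h : Nat.Coprime 40 p) [NeZero (40 * p)] (k : ZMod 40) :
    phi h k = ((k.val * p : ℕ) : ZMod (40 * p)) := by
  unfold phi; rw [natCast_mul_P h, ZMod.natCast_zmod_val]

/-- `⟨φ k⟩ = ⟨k⟩ p`. [folklore] -/
private theorem val_phi (h : Nat.Coprime 40 p) [NeZero (40 * p)] (hp : 0 < p) (k : ZMod 40) : (phi h k).val = k.val * p := by
  rw [phi_eq_natCast, ZMod.val_natCast, Nat.mod_eq_of_lt (by have := ZMod.val_lt k; nlinarith)]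

/-- `π π⁻¹ = 1` in `ℤ/40`. [folklore] -/
private theorem pi_mul_inv (h : Nat.Coprime 40 p) : π * (π)⁻¹ = 1 := ZMod.coe_mul_inv_eq_one p h.symm

/-- `pt(e, 0) = φ(e π⁻¹)`. [folklore] -/
private theorem pt_zero_eq_phi (h : Nat.Coprime 40 p) (e : ZMod 40) : pt h e 0 = phi h (e * (π)⁻¹) := by
  rw [phi, mul_assoc, mul_comm _ π, pi_mul_inv h, mul_one]

/-- The units of `ℤ/40` have inverses (kernel check). [folklore] -/
private theorem exists_inv40 : ∀ τ : ZMod 40, τ.val % 2 = 1 → τ.val % 5 ≠ 0 → ∃ τ' : ZMod 40, τ * τ' = 1 := by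
  decide

/-- `21·u = u + 20` for odd `u` and `21·f = f` for even `f` in `ℤ/40` (kernel check). [folklore] -/
private theorem twentyone_mul : ∀ u : ZMod 40, (u.val % 2 = 1 → 21 * u = u + 20) ∧ (u.val % 2 = 0 → 21 * u = u) := by
  decide

/-- A product of an odd unit residue and an odd residue is odd; times an even residue it is even (`40` is even). [folklore] -/
private theorem parity_mul (τ u : ZMod 40) : (τ * u).val % 2 = τ.val * u.val % 2 := by
  rw [ZMod.val_mul, Nat.mod_mod_of_dvd _ (by norm_num : 2 ∣ 40)]

/-- **The half-line table.** For odd `k₁, k₂ ∈ ℤ/40`: if for every unit `τ` exactly one of `⟨τk₁⟩, ⟨τk₂⟩` is `< 20`, then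
`k₂ = k₁ + 20` or `k₂ = −k₁` (kernel check over `ℤ/40`; the analogous table at `36` has further solutions). [folklore] -/
private theorem tab_half : ∀ k₁ k₂ : ZMod 40, k₁.val % 2 = 1 → k₂.val % 2 = 1 →
    (∀ τ : ZMod 40, τ.val % 2 = 1 → τ.val % 5 ≠ 0 → ((τ * k₁).val < 20 ↔ ¬ (τ * k₂).val < 20)) → k₂ = k₁ + 20 ∨ k₂ = -k₁ := by
  decide +kernel

/-- **Two odd members in the fibre `0`: the shift.** If the odd members `x = pt(e₁, 0)`, `y = pt(e₂, 0)` of `s = {x, y, z, w}` lie in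
`pℤ/40p` (`z, w` even), then `y = x + 20p`: the units `pt(τ, 1)` and `pt(21τ, 1)` agree on the even members (`21f = f` for even
`f`) and move `x, y` to `φ(τk₁), φ(τk₁) + 20p` (`21u = u + 20` for odd `u`), so the two norm equations give
`[⟨τk₁⟩ < 20] + [⟨τk₂⟩ < 20] = 1` for every unit `τ`, and the half-line table applies (`y = −x` is a pair).
[cite: Shioda1979PJA, §1 eq. (2)] -/
private theorem shift_of_fibre_zero (h : Nat.Coprime 40 p) [NeZero (40 * p)] (hp : p.Prime) (h7 : 7 ≤ p)
    {s : Multiset (ZMod (40 * p))} (hs : IsHodgeMultiset s) (hpf : ∀ a ∈ s, ∀ b ∈ s.erase a, a + b ≠ 0)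
    {x y z w : ZMod (40 * p)} (hsx : s = {x, y, z, w}) (hx1 : x.val % 2 = 1) (hy1 : y.val % 2 = 1)
    (hz0 : z.val % 2 = 0) (hw0 : w.val % 2 = 0) (hxc : (crt h x).2 = 0) (hyc : (crt h y).2 = 0) : y = x + K40 := by
  classical
  haveI := Fact.mk hp
  have hp0 := hp.pos
  have hx : x ∈ s := by rw [hsx]; simp
  have hy : y ∈ s.erase x := by rw [hsx, Multiset.insert_eq_cons, Multiset.erase_cons_head]; simp
  -- coordinates
  obtain ⟨e₁, rfl⟩ : ∃ e₁, x = pt h e₁ 0 := ⟨(crt h x).1, by conv_lhs => rw [← pt_crt h x, hxc]⟩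
  obtain ⟨e₂, rfl⟩ : ∃ e₂, y = pt h e₂ 0 := ⟨(crt h y).1, by conv_lhs => rw [← pt_crt h y, hyc]⟩
  obtain ⟨f, c, rfl⟩ : ∃ f c, z = pt h f c := ⟨_, _, (pt_crt h z).symm⟩
  obtain ⟨f', c', rfl⟩ : ∃ f' c', w = pt h f' c' := ⟨_, _, (pt_crt h w).symm⟩
  have he₁ : e₁.val % 2 = 1 := by rwa [val_pt_mod_two] at hx1
  have he₂ : e₂.val % 2 = 1 := by rwa [val_pt_mod_two] at hy1
  have hf : f.val % 2 = 0 := by rwa [val_pt_mod_two] at hz0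
  have hf' : f'.val % 2 = 0 := by rwa [val_pt_mod_two] at hw0
  set k₁ : ZMod 40 := e₁ * (π)⁻¹ with hk₁
  set k₂ : ZMod 40 := e₂ * (π)⁻¹ with hk₂
  have hxφ : pt h e₁ 0 = phi h k₁ := pt_zero_eq_phi h e₁
  have hyφ : pt h e₂ 0 = phi h k₂ := pt_zero_eq_phi h e₂
  -- `k₁, k₂` are odd
  have hk1 : k₁.val % 2 = 1 := by
    have hv : (phi h k₁).val = k₁.val * p := val_phi h hp0 k₁
    rw [← hxφ] at hv
    rw [hv, Nat.mul_mod] at hx1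
    by_contra hc
    have h0 : k₁.val % 2 = 0 := by omega
    rw [h0, zero_mul, Nat.zero_mod] at hx1
    exact absurd hx1 (by norm_num)
  have hk2 : k₂.val % 2 = 1 := by
    have hv : (phi h k₂).val = k₂.val * p := val_phi h hp0 k₂
    rw [← hyφ] at hv
    rw [hv, Nat.mul_mod] at hy1
    by_contra hc
    have h0 : k₂.val % 2 = 0 := by omega
    rw [h0, zero_mul, Nat.zero_mod] at hy1
    exact absurd hy1 (by norm_num)
  -- the norm equations at `pt(τ, 1)` and `pt(21τ, 1)`
  have key : ∀ τ : ZMod 40, τ.val % 2 = 1 → τ.val % 5 ≠ 0 → ((τ * k₁).val < 20 ↔ ¬ (τ * k₂).val < 20) := by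
    intro τ hτ1 hτ5
    obtain ⟨τ', hττ'⟩ := exists_inv40 τ hτ1 hτ5
    have h21 : (21 * τ) * (21 * τ') = 1 := by
      rw [show (21 : ZMod 40) * τ * (21 * τ') = (21 * 21) * (τ * τ') by ring, hττ']; decide
    obtain ⟨t₁, ht₁⟩ := isUnit_pt h hττ'
    obtain ⟨t₂, ht₂⟩ := isUnit_pt h h21
    have N₁ := hs.2 t₁
    have N₂ := hs.2 t₂
    rw [hsx] at N₁ N₂
    simp only [Multiset.insert_eq_cons, Multiset.map_cons, Multiset.map_singleton, Multiset.card_cons, Multiset.card_singleton,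
      mNormSum_cons, ht₁, ht₂, pt_mul, one_mul, mul_zero] at N₁ N₂
    simp only [mNormSum, Multiset.map_singleton, Multiset.sum_singleton] at N₁ N₂
    -- `21τe = τe + 20` for odd `e`, `21τf = τf` for even `f`
    have hτe₁ : (τ * e₁).val % 2 = 1 := by rw [parity_mul, Nat.mul_mod, hτ1, he₁]
    have hτe₂ : (τ * e₂).val % 2 = 1 := by rw [parity_mul, Nat.mul_mod, hτ1, he₂]
    have hτf : (τ * f).val % 2 = 0 := by rw [parity_mul, Nat.mul_mod, hf, mul_zero, Nat.zero_mod]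
    have hτf' : (τ * f').val % 2 = 0 := by rw [parity_mul, Nat.mul_mod, hf', mul_zero, Nat.zero_mod]
    have r₁ : 21 * τ * e₁ = τ * e₁ + 20 := by rw [mul_assoc]; exact (twentyone_mul _).1 hτe₁
    have r₂ : 21 * τ * e₂ = τ * e₂ + 20 := by rw [mul_assoc]; exact (twentyone_mul _).1 hτe₂
    have r₃ : 21 * τ * f = τ * f := by rw [mul_assoc]; exact (twentyone_mul _).2 hτf
    have r₄ : 21 * τ * f' = τ * f' := by rw [mul_assoc]; exact (twentyone_mul _).2 hτf'
    have s₁ : pt h (τ * e₁ + 20) 0 = pt h (τ * e₁) 0 + K40 := by rw [twentyP_eq_pt h hp h7, pt_add, add_zero]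
    have s₂ : pt h (τ * e₂ + 20) 0 = pt h (τ * e₂) 0 + K40 := by rw [twentyP_eq_pt h hp h7, pt_add, add_zero]
    rw [r₁, r₂, r₃, r₄, s₁, s₂] at N₂
    -- the representatives of `pt(τeᵢ, 0) = φ(τkᵢ)`
    have v₁ : (pt h (τ * e₁) 0).val = (τ * k₁).val * p := by
      rw [pt_zero_eq_phi, show τ * e₁ * (π)⁻¹ = τ * k₁ by rw [hk₁, mul_assoc], val_phi h hp0]
    have v₂ : (pt h (τ * e₂) 0).val = (τ * k₂).val * p := by
      rw [pt_zero_eq_phi, show τ * e₂ * (π)⁻¹ = τ * k₂ by rw [hk₂, mul_assoc], val_phi h hp0]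
    have mono : ∀ n : ℕ, n * p < 20 * p ↔ n < 20 := fun n ↦
      ⟨fun h' ↦ lt_of_mul_lt_mul_right h' (Nat.zero_le p), fun h' ↦ mul_lt_mul_of_pos_right h' hp0⟩
    have hxor : ((pt h (τ * e₁) 0).val < 20 * p ↔ ¬ (pt h (τ * e₂) 0).val < 20 * p) := by
      rcases val_add_K hp0 (pt h (τ * e₁) 0) with ⟨a₁, b₁⟩ | ⟨a₁, b₁⟩ <;>
        rcases val_add_K hp0 (pt h (τ * e₂) 0) with ⟨a₂, b₂⟩ | ⟨a₂, b₂⟩ <;> omega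
    rw [v₁, v₂, mono, mono] at hxor
    exact hxor
  rcases tab_half k₁ k₂ hk1 hk2 key with e | e
  · rw [hyφ, hxφ, e, phi_add, phi_twenty h hp h7]
  · exfalso
    apply hpf _ hx _ hy
    rw [hyφ, hxφ, e, phi_neg, add_neg_cancel]

/-! ### Case II: two odd members `x, x + 20p` -/

/-- **Two odd members `x, x + 20p` (`s` not inside `pℤ`):** `T(s) = 2·{x̄, ẑ, ŵ}` and `{x̄, ẑ, ŵ, 10p}` is a Hodge quadruple of
level `20p`; it has a pair exactly when `s = α_x`, and otherwise it is the level-`20p` `α_y` with `y ∈ {x̄, x̄ + 10p}` (the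
level-`20p` `β_y` cannot contain `10p`, and a lifted level-`20` quadruple would put `s` inside `pℤ`), i.e. `s = β_x`.
[cite: Shioda1982PicardFermat, Prop. 4 (Q′) p. 729] [cite: AokiShioda1983, §2 Theorem (𝔅²ₘ) (ii) a), b), p. 3] [cite: Aoki1983, Prop. 2.2] -/
private theorem case_two_odd (h : Nat.Coprime 40 p) [NeZero (40 * p)] (hp : p.Prime) (h19 : 19 ≤ p)
    {s : Multiset (ZMod (40 * p))} (hs : IsHodgeMultiset s)
    {x z w : ZMod (40 * p)} (hsx : s = {x, x + K40, z, w}) (hx1 : x.val % 2 = 1)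
    (hz0 : z.val % 2 = 0) (hw0 : w.val % 2 = 0) (hex : ∃ v ∈ s, (crt h v).2 ≠ 0) :
    s = {x, x + K40, -(2 * x), K40} ∨ s = {x, x + K40, 2 * x + K40, -(4 * x)} := by
  classical
  haveI := Fact.mk hp
  have hp0 := hp.pos
  have hp2 : p % 2 = 1 := Nat.odd_iff.mp (hp.odd_of_ne_two (by omega))
  have h7 : 7 ≤ p := by omega
  haveI : NeZero (20 * p) := ⟨by omega⟩
  have hnm : 20 * p ∣ 40 * p := ⟨2, by ring⟩
  have hz : z ∈ s := by rw [hsx]; simp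
  have hw : w ∈ s := by rw [hsx]; simp
  have hz_ne : z ≠ 0 := hs.1.1 z hz
  have hw_ne : w ≠ 0 := hs.1.1 w hw
  -- the transfer `T(s) = 2·{x̄, ẑ, ŵ}`
  have hxK1 : (x + K40).val % 2 = 1 := by
    rcases val_add_K hp0 x with ⟨e, -⟩ | ⟨e, -⟩ <;> omega
  have hsplit : s = ({x, x + K40} : Multiset (ZMod (40 * p))) + {z, w} := by rw [hsx, pair_add_pair]
  have hT := isHodgeMultiset_transfer_fortyPrime hp0 hnm (so := {x, x + K40}) (se := {z, w})
    (by intro v hv; simp only [Multiset.insert_eq_cons, Multiset.mem_cons, Multiset.mem_singleton] at hv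
        rcases hv with rfl | rfl <;> assumption)
    (by intro v hv; simp only [Multiset.insert_eq_cons, Multiset.mem_cons, Multiset.mem_singleton] at hv
        rcases hv with rfl | rfl <;> assumption)
    (hsplit ▸ hs)
  have hRK : ZMod.castHom hnm (ZMod (20 * p)) (x + K40) = ZMod.castHom hnm (ZMod (20 * p)) x := by
    rw [_root_.map_add, map_natCast, ZMod.natCast_self, add_zero]
  simp only [Multiset.insert_eq_cons, Multiset.map_cons, Multiset.map_singleton, hRK] at hT
  set xb := ZMod.castHom hnm (ZMod (20 * p)) x with hxb
  set zt := ZMod.castHom hnm (ZMod (20 * p)) (half z) with hzt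
  set wt := ZMod.castHom hnm (ZMod (20 * p)) (half w) with hwt
  have hxb0 : xb ≠ 0 := castHom_ne_zero_of_odd hnm hx1
  have hzt0 : zt ≠ 0 := castHom_half_ne_zero hnm hz_ne hz0
  have hwt0 : wt ≠ 0 := castHom_half_ne_zero hnm hw_ne hw0
  have hK50 : L20 ≠ 0 := L20_ne_zero hp0
  have hxodd : xb.val % 2 = 1 := by rw [hxb, val_castHom_mod_two hnm, hx1]
  -- `x̄ ≠ 10p` (parity)
  have hLeven : (L20).val % 2 = 0 := by rw [val_L20 hp0]; omega
  have hxbK : xb ≠ L20 := fun e ↦ by rw [e] at hxodd; omega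
  -- the fibres: reduction to `ℤ/p`
  set ρ := ZMod.castHom (dvd_mul_left p 20) (ZMod p) with hρ
  have hρR : ∀ v : ZMod (40 * p), ρ (ZMod.castHom hnm (ZMod (20 * p)) v) = (crt h v).2 := by
    intro v
    rw [crt_snd, hρ, ZMod.castHom_apply, ZMod.cast_eq_val, val_castHom, ZMod.natCast_eq_natCast_iff',
      Nat.mod_mod_of_dvd _ (dvd_mul_left p 20)]
  have hρK : ρ L20 = 0 := by rw [map_natCast, Nat.cast_mul, ZMod.natCast_self, mul_zero]
  -- norms and sum of `{x̄, ẑ, ŵ}`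
  obtain ⟨⟨-, hTsum⟩, hTnorm⟩ := hT
  have hA : ∀ v : (ZMod (20 * p))ˣ,
      ((v : ZMod (20 * p)) * xb).val + ((v : ZMod (20 * p)) * zt).val + ((v : ZMod (20 * p)) * wt).val = 30 * p := by
    intro v
    have e := hTnorm v
    simp only [Multiset.map_add, Multiset.map_cons, Multiset.map_singleton, mNormSum_add, mNormSum_cons,
      Multiset.card_add, Multiset.card_cons, Multiset.card_singleton] at e
    simp only [mNormSum, Multiset.map_singleton, Multiset.sum_singleton] at e
    omega
  have hsum3 : xb + zt + wt = L20 := by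
    have h2 : (2 : ZMod (20 * p)) * (xb + zt + wt) = 0 := by
      simp only [Multiset.sum_add, Multiset.sum_cons, Multiset.sum_singleton] at hTsum
      linear_combination hTsum
    rcases (two_mul_eq_zero_twentyP hp0).mp h2 with e | e
    · exfalso
      have h1 := hA 1
      simp only [Units.val_one, one_mul] at h1
      have hcast : (((xb.val + zt.val + wt.val : ℕ)) : ZMod (20 * p)) = xb + zt + wt := by
        push_cast; simp only [ZMod.natCast_zmod_val]
      rw [h1, e, show ((30 * p : ℕ) : ZMod (20 * p)) = L20 + ((20 * p : ℕ) : ZMod (20 * p)) by push_cast; ring,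
        ZMod.natCast_self, add_zero] at hcast
      exact hK50 hcast
    · exact e
  -- `τ = {x̄, ẑ, ŵ, 10p}` is a Hodge quadruple of level `20p`
  have hτ : IsHodgeMultiset ({xb, zt, wt, L20} : Multiset (ZMod (20 * p))) := by
    refine ⟨⟨?_, ?_⟩, fun v ↦ ?_⟩
    · intro a ha
      simp only [Multiset.insert_eq_cons, Multiset.mem_cons, Multiset.mem_singleton] at ha
      rcases ha with rfl | rfl | rfl | rfl <;> assumption
    · simp only [Multiset.insert_eq_cons, Multiset.sum_cons, Multiset.sum_singleton]
      linear_combination hsum3 - neg_L20 (p := p)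
    · have hvK : ((v : ZMod (20 * p)) * L20).val = 10 * p := by
        rw [unit_mul_natCast_half (m := 20 * p) (K := 10 * p) (by ring) v, val_L20 hp0]
      simp only [Multiset.insert_eq_cons, Multiset.map_cons, Multiset.map_singleton, mNormSum_cons, Multiset.card_cons,
        Multiset.card_singleton]
      simp only [mNormSum, Multiset.map_singleton, Multiset.sum_singleton, hvK]
      have := hA v
      omega
  -- the doubles
  have hdx : dbl xb = 2 * x := dbl_castHom hnm x
  have hdz : dbl zt = z := dbl_castHom_half hnm hz0
  have hdw : dbl wt = w := dbl_castHom_half hnm hw0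
  have hdK : dbl L20 = K40 := dbl_L20 hp0
  -- (i) `τ` has a pair: `s = α_x`
  by_cases h1 : xb + zt = 0
  · left
    have ezt : zt = -xb := by linear_combination h1
    have ewt : wt = L20 := by linear_combination hsum3 - h1
    have ez : z = -(2 * x) := by rw [← hdz, ezt, dbl_neg, hdx]
    have ew : w = K40 := by rw [← hdw, ewt, hdK]
    rw [hsx, ez, ew]
  by_cases h2 : xb + wt = 0
  · left
    have ewt : wt = -xb := by linear_combination h2
    have ezt : zt = L20 := by linear_combination hsum3 - h2
    have ez : z = K40 := by rw [← hdz, ezt, hdK]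
    have ew : w = -(2 * x) := by rw [← hdw, ewt, dbl_neg, hdx]
    rw [hsx, ez, ew]
    simp only [Multiset.insert_eq_cons, ← Multiset.singleton_add]; abel
  -- (ii) `τ` is pair-free: `τ = A_y`, `y ∈ {x̄, x̄ + 10p}`, and `s = β_x`
  right
  have h3 : zt + wt ≠ 0 := fun e ↦ hxbK (by linear_combination hsum3 - e)
  have h4 : zt ≠ L20 := fun e ↦ h2 (by linear_combination hsum3 - e)
  have h5' : wt ≠ L20 := fun e ↦ h1 (by linear_combination hsum3 - e)
  have hτpf : ∀ a ∈ ({xb, zt, wt, L20} : Multiset (ZMod (20 * p))), ∀ b ∈ (({xb, zt, wt, L20} : Multiset (ZMod (20 * p)))).erase a,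
      a + b ≠ 0 :=
    pairfree_quad h1 h2 (fun e ↦ hxbK (by linear_combination e + neg_L20 (p := p))) h3
      (fun e ↦ h4 (by linear_combination e + neg_L20 (p := p))) (fun e ↦ h5' (by linear_combination e + neg_L20 (p := p)))
  have hc4 : Multiset.card ({xb, zt, wt, L20} : Multiset (ZMod (20 * p))) = 4 := rfl
  obtain ⟨y, hy⟩ := classify_hodgeMultiset_twentyPrime hp h19 hτ hc4 hτpf
  rcases hy with e | e | ⟨⟨t, ht, hty⟩, e⟩
  · -- type `α` (level `20p`): cancel `10p`
    have e3 : ({xb, zt, wt} : Multiset (ZMod (20 * p))) = {y, y + L20, -(2 * y)} := by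
      have e' : ({xb, zt, wt} : Multiset (ZMod (20 * p))) + {L20} = {y, y + L20, -(2 * y)} + {L20} := by
        simpa only [Multiset.insert_eq_cons, Multiset.cons_add, Multiset.singleton_add] using e
      exact add_right_cancel e'
    have hxmem3 : xb ∈ ({y, y + L20, -(2 * y)} : Multiset (ZMod (20 * p))) := by rw [← e3]; simp
    simp only [Multiset.insert_eq_cons, Multiset.mem_cons, Multiset.mem_singleton] at hxmem3
    obtain ⟨y', e4, hy'⟩ : ∃ y' : ZMod (20 * p),
        ({xb, zt, wt} : Multiset (ZMod (20 * p))) = {y', y' + L20, -(2 * y')} ∧ xb = y' := by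
      rcases hxmem3 with e4 | e4 | e4
      · exact ⟨y, e3, e4⟩
      · refine ⟨y + L20, ?_, e4⟩
        rw [e3, show y + L20 + L20 = y by linear_combination -(neg_L20 (p := p)),
          show -(2 * (y + L20)) = -(2 * y) by linear_combination neg_L20 (p := p)]
        simp only [Multiset.insert_eq_cons, ← Multiset.singleton_add]; abel
      · exfalso
        rw [e4, val_neg_mod_two_twenty, val_two_mul_mod_two_twenty] at hxodd
        omega
    rw [← hy'] at e4
    have e5 : ({zt, wt} : Multiset (ZMod (20 * p))) = {xb + L20, -(2 * xb)} := by
      simp only [Multiset.insert_eq_cons] at e4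
      exact (Multiset.cons_inj_right _).mp e4
    have e6 := congrArg (Multiset.map dbl) e5
    simp only [Multiset.insert_eq_cons, Multiset.map_cons, Multiset.map_singleton, hdz, hdw, dbl_add, dbl_neg,
      dbl_two_mul, hdx, hdK] at e6
    rw [hsx, show -(4 * x) = -(2 * (2 * x)) by ring]
    simp only [Multiset.insert_eq_cons]
    rw [e6]
  · -- type `β` (level `20p`): `10p ∈ β_y` is impossible
    exfalso
    have hmem : L20 ∈ ({y, y + L20, 2 * y + L20, -(4 * y)} : Multiset (ZMod (20 * p))) := by rw [← e]; simp
    have hne : ∀ a ∈ ({y, y + L20, 2 * y + L20, -(4 * y)} : Multiset (ZMod (20 * p))), a ≠ 0 := by rw [← e]; exact hτ.1.1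
    have hy0 : y ≠ 0 := hne y (by simp)
    have hyK0 : y + L20 ≠ 0 := hne (y + L20) (by simp)
    simp only [Multiset.insert_eq_cons, Multiset.mem_cons, Multiset.mem_singleton] at hmem
    rcases hmem with e' | e' | e' | e'
    · exact hyK0 (by rw [← e']; linear_combination -(neg_L20 (p := p)))
    · exact hy0 (by linear_combination -e')
    · have h2y : (2 : ZMod (20 * p)) * y = 0 := by linear_combination -e'
      rcases (two_mul_eq_zero_twentyP hp0).mp h2y with e'' | e''
      · exact hy0 e''
      · exact hyK0 (by rw [e'']; linear_combination -(neg_L20 (p := p)))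
    · -- `4y = 10p` is impossible modulo `4` (`p` odd)
      have e4 : (4 : ZMod (20 * p)) * y = L20 := by linear_combination e' + neg_L20 (p := p)
      have h4 := congrArg (ZMod.castHom (⟨5 * p, by ring⟩ : 4 ∣ 20 * p) (ZMod 4)) e4
      rw [_root_.map_mul, map_ofNat, map_natCast, show (4 : ZMod 4) = 0 from by decide, zero_mul, eq_comm,
        ZMod.natCast_eq_zero_iff] at h4
      omega
  · -- a lifted exceptional quadruple of level `20`: then `s ⊂ pℤ`
    exfalso
    have hρy : ρ y = 0 := by rw [hty, map_natCast, Nat.cast_mul, ZMod.natCast_self, mul_zero]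
    have hall : ∀ a ∈ ({xb, zt, wt, L20} : Multiset (ZMod (20 * p))), ρ a = 0 := by
      intro a ha
      rcases e with e | e | e | e <;> rw [e] at ha <;>
        simp only [Multiset.insert_eq_cons, Multiset.mem_cons, Multiset.mem_singleton] at ha <;>
        rcases ha with rfl | rfl | rfl | rfl <;> simp [map_mul, hρy]
    have hK2 : (crt h K40).2 = 0 := by rw [twentyP_eq_pt h hp h7, crt_pt]
    have hx2 : (crt h x).2 = 0 := by rw [← hρR]; exact hall xb (by simp)
    have h22 : (crt h (2 : ZMod (40 * p)) * crt h (half z)).2 = (crt h 2).2 * (crt h (half z)).2 := rfl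
    have hz2 : (crt h z).2 = 0 := by
      have hh : (crt h (half z)).2 = 0 := by rw [← hρR]; exact hall zt (by simp)
      rw [← two_mul_half hz0, _root_.map_mul, Prod.snd_mul, hh, mul_zero]
    have hw2 : (crt h w).2 = 0 := by
      have hh : (crt h (half w)).2 = 0 := by rw [← hρR]; exact hall wt (by simp)
      rw [← two_mul_half hw0, _root_.map_mul, Prod.snd_mul, hh, mul_zero]
    obtain ⟨v, hv, hvc⟩ := hex
    rw [hsx] at hv
    simp only [Multiset.insert_eq_cons, Multiset.mem_cons, Multiset.mem_singleton] at hv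
    rcases hv with rfl | rfl | rfl | rfl
    · exact hvc hx2
    · exact hvc (by rw [_root_.map_add, Prod.snd_add, hx2, hK2, add_zero])
    · exact hvc hz2
    · exact hvc hw2

/-! ### Case III: four odd members -/

/-- **All members odd, one off the fibre `0`: impossible.** `s̄ = s mod 20p` is a Hodge quadruple of level `20p` with odd
members; the level-`20p` types `α`, `β` have an even member and the only all-odd lifted level-`20` quadruples lie in `pℤ`, so `s̄`
has a pair and `s = {u₁, 20p − u₁, u₃, 20p − u₃}`, which violates the relations (`halfpair_odd`).
[cite: AokiShioda1983, §2 Theorem (𝔅²ₘ) (ii), p. 3] [cite: Aoki1983, Prop. 2.2] -/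
private theorem case_all_odd (h : Nat.Coprime 40 p) [NeZero (40 * p)] (hp : p.Prime) (h19 : 19 ≤ p)
    {s : Multiset (ZMod (40 * p))} (hs : IsHodgeMultiset s) (hcard : Multiset.card s = 4)
    (hpf : ∀ a ∈ s, ∀ b ∈ s.erase a, a + b ≠ 0) (hodd : ∀ w ∈ s, w.val % 2 = 1) (hex : ∃ w ∈ s, (crt h w).2 ≠ 0) :
    False := by
  classical
  haveI := Fact.mk hp
  have hp0 := hp.pos
  have h7 : 7 ≤ p := by omega
  haveI : NeZero (20 * p) := ⟨by omega⟩
  have hnm : 20 * p ∣ 40 * p := ⟨2, by ring⟩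
  have hT := isHodgeMultiset_transfer_fortyPrime hp0 hnm (so := s) (se := 0) hodd (by simp) (by simpa using hs)
  simp only [Multiset.map_zero, add_zero] at hT
  have hc4 : Multiset.card (s.map (ZMod.castHom hnm (ZMod (20 * p)))) = 4 := by rw [Multiset.card_map, hcard]
  have hRel := rels0_of_rels hp h19 (by rw [Multiset.card_map, hcard]) (rels_of_isHodgeMultiset h hp h7 hs)
  have hRodd : ∀ a ∈ s.map (ZMod.castHom hnm (ZMod (20 * p))), a.val % 2 = 1 := by
    intro a ha
    obtain ⟨w, hw, rfl⟩ := Multiset.mem_map.mp ha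
    rw [val_castHom_mod_two hnm, hodd w hw]
  -- the fibres: reduction to `ℤ/p`
  set ρ := ZMod.castHom (dvd_mul_left p 20) (ZMod p) with hρ
  have hρR : ∀ v : ZMod (40 * p), ρ (ZMod.castHom hnm (ZMod (20 * p)) v) = (crt h v).2 := by
    intro v
    rw [crt_snd, hρ, ZMod.castHom_apply, ZMod.cast_eq_val, val_castHom, ZMod.natCast_eq_natCast_iff',
      Nat.mod_mod_of_dvd _ (dvd_mul_left p 20)]
  by_cases hpair : ∀ a ∈ s.map (ZMod.castHom hnm (ZMod (20 * p))),
      ∀ b ∈ (s.map (ZMod.castHom hnm (ZMod (20 * p)))).erase a, a + b ≠ 0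
  · -- `s̄` pair-free: `α_y` or `β_y`, both with an even member, or a lift inside `pℤ`
    obtain ⟨y, hy⟩ := classify_hodgeMultiset_twentyPrime hp h19 hT hc4 hpair
    rcases hy with e | e | ⟨⟨t, ht, hty⟩, e⟩
    · have := hRodd (-(2 * y)) (by rw [e]; simp)
      rw [val_neg_mod_two_twenty, val_two_mul_mod_two_twenty] at this
      omega
    · have := hRodd (-(4 * y)) (by rw [e]; simp)
      rw [val_neg_mod_two_twenty, show (4 : ZMod (20 * p)) * y = 2 * (2 * y) by ring, val_two_mul_mod_two_twenty] at this
      omega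
    · have hρy : ρ y = 0 := by rw [hty, map_natCast, Nat.cast_mul, ZMod.natCast_self, mul_zero]
      have hall : ∀ a ∈ s.map (ZMod.castHom hnm (ZMod (20 * p))), ρ a = 0 := by
        intro a ha
        rcases e with e | e | e | e <;> rw [e] at ha <;>
          simp only [Multiset.insert_eq_cons, Multiset.mem_cons, Multiset.mem_singleton] at ha <;>
          rcases ha with rfl | rfl | rfl | rfl <;> simp [map_mul, hρy]
      obtain ⟨v, hv, hvc⟩ := hex
      exact hvc (by rw [← hρR]; exact hall _ (Multiset.mem_map_of_mem _ hv))
  · -- `s̄` has a pair: `s = {u₁, 20p − u₁, u₃, 20p − u₃}`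
    push Not at hpair
    obtain ⟨a, ha, b, hb, hab⟩ := hpair
    obtain ⟨u₁, hu₁, rfl⟩ := Multiset.mem_map.mp ha
    rw [← Multiset.map_erase_of_mem _ _ hu₁] at hb
    obtain ⟨u₂, hu₂, rfl⟩ := Multiset.mem_map.mp hb
    have hK0 : ZMod.castHom hnm (ZMod (20 * p)) K40 = 0 := by rw [map_natCast, ZMod.natCast_self]
    rcases lift_eq hp0 hnm (a := u₂) (b := -u₁) (by rw [_root_.map_neg]; linear_combination hab) with e2 | e2
    · exact hpf u₁ hu₁ u₂ hu₂ (by rw [e2, add_neg_cancel])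
    -- the other two members
    obtain ⟨t, ht⟩ : ∃ t, s = u₁ ::ₘ u₂ ::ₘ t := by
      obtain ⟨t, ht⟩ := Multiset.exists_cons_of_mem hu₂
      exact ⟨t, by rw [← Multiset.cons_erase hu₁, ht]⟩
    have hct : Multiset.card t = 2 := by
      rw [ht, Multiset.card_cons, Multiset.card_cons] at hcard; omega
    obtain ⟨u₃, u₄, rfl⟩ := Multiset.card_eq_two.mp hct
    have hu₃ : u₃ ∈ s := by rw [ht]; simp
    have hu₄ : u₄ ∈ s.erase u₃ := by
      rw [ht, show u₁ ::ₘ u₂ ::ₘ ({u₃, u₄} : Multiset (ZMod (40 * p))) = u₃ ::ₘ u₁ ::ₘ u₂ ::ₘ {u₄} by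
        simp only [Multiset.insert_eq_cons, ← Multiset.singleton_add]; abel, Multiset.erase_cons_head]
      simp
    have hτ : IsHodgeMultiset ({ZMod.castHom hnm (ZMod (20 * p)) u₃, ZMod.castHom hnm (ZMod (20 * p)) u₄} :
        Multiset (ZMod (20 * p))) := by
      have e3 : s.map (ZMod.castHom hnm (ZMod (20 * p))) = ZMod.castHom hnm (ZMod (20 * p)) u₁ ::ₘ
          (-ZMod.castHom hnm (ZMod (20 * p)) u₁) ::ₘ {ZMod.castHom hnm (ZMod (20 * p)) u₃, ZMod.castHom hnm (ZMod (20 * p)) u₄} := by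
        rw [ht]
        simp only [Multiset.map_cons, Multiset.insert_eq_cons, Multiset.map_singleton, e2, _root_.map_add, _root_.map_neg, hK0, add_zero]
      rw [e3] at hT
      exact isHodgeMultiset_of_cons_cons_neg hT
    have e4 := eq_neg_of_isHodgeMultiset_pair hτ
    rcases lift_eq hp0 hnm (a := u₄) (b := -u₃) (by rw [_root_.map_neg]; exact e4) with e5 | e5
    · exact hpf u₃ hu₃ u₄ hu₄ (by rw [e5, add_neg_cancel])
    -- order the two half-pairs so that the first is off the fibre `0`
    have hsw : s = {u₁, -u₁ + K40, u₃, -u₃ + K40} := by rw [ht, e2, e5]; rfl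
    have hord : ∃ v₁ v₃ : ZMod (40 * p), (crt h v₁).2 ≠ 0 ∧ s = {v₁, -v₁ + K40, v₃, -v₃ + K40} := by
      by_cases h₁ : (crt h u₁).2 ≠ 0
      · exact ⟨u₁, u₃, h₁, hsw⟩
      · push Not at h₁
        refine ⟨u₃, u₁, ?_, by rw [hsw]; simp only [Multiset.insert_eq_cons, ← Multiset.singleton_add]; abel⟩
        obtain ⟨w, hw, hw0⟩ := hex
        rw [hsw] at hw
        have hK2 : (crt h K40).2 = 0 := by rw [twentyP_eq_pt h hp h7, crt_pt]
        simp only [Multiset.insert_eq_cons, Multiset.mem_cons, Multiset.mem_singleton] at hw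
        rcases hw with rfl | rfl | rfl | rfl
        · exact absurd h₁ hw0
        · exfalso; apply hw0; rw [_root_.map_add, Prod.snd_add, _root_.map_neg, Prod.snd_neg, h₁, hK2, neg_zero, add_zero]
        · exact hw0
        · intro h₃; apply hw0; rw [_root_.map_add, Prod.snd_add, _root_.map_neg, Prod.snd_neg, h₃, hK2, neg_zero, add_zero]
    obtain ⟨v₁, v₃, hc, hsv⟩ := hord
    have hv₁ : v₁ ∈ s := by rw [hsv]; simp
    have hv₃ : v₃ ∈ s.erase v₁ := by rw [hsv, Multiset.insert_eq_cons, Multiset.erase_cons_head]; simp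
    have hv₃' : -v₃ + K40 ∈ s.erase v₁ := by rw [hsv, Multiset.insert_eq_cons, Multiset.erase_cons_head]; simp
    have hv₃s : v₃ ∈ s := Multiset.mem_of_mem_erase hv₃
    obtain ⟨e₀, c, rfl⟩ : ∃ e₀ c, v₁ = pt h e₀ c := ⟨_, _, (pt_crt h v₁).symm⟩
    obtain ⟨f, c', rfl⟩ : ∃ f c', v₃ = pt h f c' := ⟨_, _, (pt_crt h v₃).symm⟩
    simp only [crt_pt] at hc
    have he₀ : e₀.val % 2 = 1 := by rw [← val_pt_mod_two h e₀ c]; exact hodd _ hv₁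
    have hf : f.val % 2 = 1 := by rw [← val_pt_mod_two h f c']; exact hodd _ hv₃s
    have hK' : ∀ (e : ZMod 40) (b : ZMod p), -(pt h e b) + K40 = pt h (20 - e) (-b) := by
      intro e b
      rw [twentyP_eq_pt h hp h7, neg_pt, pt_add, add_zero, show -e + 20 = 20 - e by ring]
    have hz1 : ((f, c') : ZMod 40 × ZMod p) ≠ -(e₀, c) := by
      intro hq
      apply hpf _ hv₁ _ hv₃
      have : crt h (pt h f c') = crt h (-(pt h e₀ c)) := by rw [crt_pt, _root_.map_neg, crt_pt]; exact hq
      have := (crt h).injective this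
      rw [this, add_neg_cancel]
    have hz2 : ((20 - f, -c') : ZMod 40 × ZMod p) ≠ -(e₀, c) := by
      intro hq
      apply hpf _ hv₁ _ hv₃'
      have : crt h (-(pt h f c') + K40) = crt h (-(pt h e₀ c)) := by rw [hK', crt_pt, _root_.map_neg, crt_pt]; exact hq
      have := (crt h).injective this
      rw [this, add_neg_cancel]
    refine halfpair_odd hp h19 he₀ hf hc ?_ hz1 hz2
    rw [hsv, hK', hK'] at hRel
    simp only [Multiset.insert_eq_cons, Multiset.map_cons, Multiset.map_singleton, crt_pt] at hRel
    exact hRel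

/-! ### Assembly -/

/-- **Classification of the pair-free Hodge `4`-multisets of level `40p`, `p ≥ 19` prime** (multiset form of Shioda's Prop. 4 (Q′) /
Aoki–Shioda's Theorem (𝔅²ₘ) (ii) at `m = 40p`, together with the exceptional quadruples of the levels `40` and `20`). A pair-free Hodge
`4`-multiset over `ℤ/40p` is `{x, x + 20p, −2x, 20p}` (type `α`, `m′ = 20p`) or `{x, x + 20p, 2x + 20p, −4x}` (type `β`) for some
residue `x`, or `x·r` with `x = t p`, `t` a unit of `ℤ/40`, and `r` one of the six shapes `(1, 21, 24, 34)`, `(1, 21, 26, 32)` (Tabelle 1,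
`N = 40`), `(2, 8, 34, 36)`, `(2, 12, 32, 34)`, `(2, 18, 26, 34)`, `(2, 20, 24, 34)` (twice the rows of `N = 20`) — `42` multisets (orbit
sizes `8, 8, 8, 8, 2, 8`). PROOF: the character relations `Z_R`, `Z_I`, `E₈`, `Γ₋₈` of `KoblitzOgusRelationsFortyPrime` (from
`KoblitzOgus.hodge_eq_combination`), the transfer to level `20p` (`isHodgeMultiset_transfer_fortyPrime` +
`classify_hodgeMultiset_twentyPrime`), the kernel table of level `40` (`classify_hodgeMultiset_forty`) and the norm equations at the
units `pt(τ, 1)`, `pt(21τ, 1)`, by the number of odd members: `fibre_zero`, `case_all_even`, `two_odd_core` / `shift_of_fibre_zero` +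
`case_two_odd`, `case_all_odd`.
[cite: Shioda1982PicardFermat, §4 Lemma 1 p. 728, Prop. 4 (Q′) p. 729 and table p. 727 (m = 40)]
[cite: AokiShioda1983, §2 Theorem (𝔅²ₘ) (ii) a), b), p. 3] [cite: MeyerNeutsch1981Fermatquadrupel, Tabelle 1 p. 54 (N = 20, 40)]
[cite: Aoki1983, Prop. 2.2] [cite: Deligne1982HodgeCycles, Rem. 7.16 (a)] -/
theorem classify_hodgeMultiset_fortyPrime [NeZero (40 * p)] (hp : p.Prime) (h19 : 19 ≤ p)
    {s : Multiset (ZMod (40 * p))} (hs : IsHodgeMultiset s) (hcard : Multiset.card s = 4)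
    (hind : ∀ a ∈ s, ∀ b ∈ s.erase a, a + b ≠ 0) :
    ∃ x : ZMod (40 * p), s = {x, x + K40, -(2 * x), K40} ∨ s = {x, x + K40, 2 * x + K40, -(4 * x)} ∨
      ((∃ t : ℕ, (t = 1 ∨ t = 3 ∨ t = 7 ∨ t = 9 ∨ t = 11 ∨ t = 13 ∨ t = 17 ∨ t = 19 ∨ t = 21 ∨ t = 23 ∨ t = 27 ∨ t = 29 ∨ t = 31 ∨
          t = 33 ∨ t = 37 ∨ t = 39) ∧ x = ((t * p : ℕ) : ZMod (40 * p))) ∧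
        (s = {x, 21 * x, 24 * x, 34 * x} ∨ s = {x, 21 * x, 26 * x, 32 * x} ∨ s = {2 * x, 8 * x, 34 * x, 36 * x} ∨
          s = {2 * x, 12 * x, 32 * x, 34 * x} ∨ s = {2 * x, 18 * x, 26 * x, 34 * x} ∨ s = {2 * x, 20 * x, 24 * x, 34 * x})) := by
  classical
  have h7 : 7 ≤ p := by omega
  have h := coprime_forty hp h7
  -- the fibre `0`
  by_cases hex : ∃ w ∈ s, (crt h w).2 ≠ 0
  swap
  · push Not at hex
    exact fibre_zero h hp hs hcard hind hex
  -- split by parity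
  set so := s.filter fun w ↦ w.val % 2 = 1 with hso
  set se := s.filter fun w ↦ ¬ w.val % 2 = 1 with hse
  have hsplit : s = so + se := (Multiset.filter_add_not _ s).symm
  have hcs : Multiset.card so + Multiset.card se = 4 := by rw [← Multiset.card_add, ← hsplit, hcard]
  have heven : Even (Multiset.card so) := even_card_filter_odd hs.1.2
  have hso1 : ∀ v ∈ so, v.val % 2 = 1 := fun v hv ↦ (Multiset.mem_filter.mp hv).2
  have hse0 : ∀ v ∈ se, v.val % 2 = 0 := fun v hv ↦ by have := (Multiset.mem_filter.mp hv).2; omega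
  obtain ⟨k, hk⟩ := heven
  have hk2 : k ≤ 2 := by omega
  interval_cases k
  · -- no odd member
    have h0 : so = 0 := Multiset.card_eq_zero.mp (by omega)
    rw [h0, zero_add] at hsplit
    exact case_all_even hp h19 hs hcard hind fun v hv ↦ hse0 v (hsplit ▸ hv)
  · -- two odd members
    have h2 : Multiset.card so = 2 := by omega
    have h2' : Multiset.card se = 2 := by omega
    obtain ⟨x, y, hxy⟩ := Multiset.card_eq_two.mp h2
    obtain ⟨z, w, hzw⟩ := Multiset.card_eq_two.mp h2'
    have hx1 : x.val % 2 = 1 := hso1 x (by rw [hxy]; simp)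
    have hy1 : y.val % 2 = 1 := hso1 y (by rw [hxy]; simp)
    have hz0 : z.val % 2 = 0 := hse0 z (by rw [hzw]; simp)
    have hw0 : w.val % 2 = 0 := hse0 w (by rw [hzw]; simp)
    have hsx : s = {x, y, z, w} := by rw [hsplit, hxy, hzw, pair_add_pair]
    have hsy : s = {y, x, z, w} := by rw [hsx]; simp only [Multiset.insert_eq_cons]; exact Multiset.cons_swap x y _
    -- the odd members are `{x, x + 20p}` (after renaming)
    have hshift : ∃ x' y' : ZMod (40 * p), s = {x', y', z, w} ∧ x'.val % 2 = 1 ∧ y' = x' + K40 := by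
      by_cases hxc : (crt h x).2 ≠ 0
      · refine ⟨x, y, hsx, hx1, ?_⟩
        -- relations on the odd part `{crt x, crt y}`
        have hRel := rels0_of_rels hp h19 (by rw [Multiset.card_map, hcard]) (rels_of_isHodgeMultiset h hp h7 hs)
        have hsw : s = {z, w, x, y} := by
          rw [hsx]; simp only [Multiset.insert_eq_cons, ← Multiset.singleton_add]; abel
        rw [hsw] at hRel
        simp only [Multiset.insert_eq_cons, Multiset.map_cons, Multiset.map_singleton] at hRel
        have hO := (hRel.of_cons_even (by rw [fst_val_mod_two]; exact hz0)).of_cons_even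
          (by rw [fst_val_mod_two]; exact hw0)
        have hex' : (crt h x).1.val % 2 = 1 := by rw [fst_val_mod_two]; exact hx1
        have hey : (crt h y).1.val % 2 = 1 := by rw [fst_val_mod_two]; exact hy1
        have hxs : x ∈ s := by rw [hsx]; simp
        have hys : y ∈ s.erase x := by rw [hsx, Multiset.insert_eq_cons, Multiset.erase_cons_head]; simp
        have hyx : (((crt h y).1, (crt h y).2) : ZMod 40 × ZMod p) ≠ -((crt h x).1, (crt h x).2) := by
          rw [Prod.mk.eta, Prod.mk.eta, ← _root_.map_neg, (crt h).injective.ne_iff]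
          intro e; exact hind x hxs y hys (by rw [e, add_neg_cancel])
        obtain ⟨he', hc'⟩ := two_odd_core hp h19 hO (e := (crt h x).1) (c := (crt h x).2) (e' := (crt h y).1)
          (c' := (crt h y).2) (by simp only [Prod.mk.eta, Multiset.insert_eq_cons]) hex' hey hxc hyx
        have e1 : pt h ((crt h x).1 + 20) (crt h x).2 = pt h (crt h x).1 (crt h x).2 + pt h 20 0 := by rw [pt_add, add_zero]
        rw [← pt_crt h y, he', hc', e1, pt_crt, twentyP_eq_pt h hp h7]
      by_cases hyc : (crt h y).2 ≠ 0
      · refine ⟨y, x, hsy, hy1, ?_⟩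
        have hRel := rels0_of_rels hp h19 (by rw [Multiset.card_map, hcard]) (rels_of_isHodgeMultiset h hp h7 hs)
        have hsw : s = {z, w, y, x} := by
          rw [hsx]; simp only [Multiset.insert_eq_cons, ← Multiset.singleton_add]; abel
        rw [hsw] at hRel
        simp only [Multiset.insert_eq_cons, Multiset.map_cons, Multiset.map_singleton] at hRel
        have hO := (hRel.of_cons_even (by rw [fst_val_mod_two]; exact hz0)).of_cons_even
          (by rw [fst_val_mod_two]; exact hw0)
        have hex' : (crt h x).1.val % 2 = 1 := by rw [fst_val_mod_two]; exact hx1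
        have hey : (crt h y).1.val % 2 = 1 := by rw [fst_val_mod_two]; exact hy1
        have hys : y ∈ s := by rw [hsy]; simp
        have hxs : x ∈ s.erase y := by rw [hsy, Multiset.insert_eq_cons, Multiset.erase_cons_head]; simp
        have hxy' : (((crt h x).1, (crt h x).2) : ZMod 40 × ZMod p) ≠ -((crt h y).1, (crt h y).2) := by
          rw [Prod.mk.eta, Prod.mk.eta, ← _root_.map_neg, (crt h).injective.ne_iff]
          intro e; exact hind y hys x hxs (by rw [e, add_neg_cancel])
        obtain ⟨he', hc'⟩ := two_odd_core hp h19 hO (e := (crt h y).1) (c := (crt h y).2) (e' := (crt h x).1)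
          (c' := (crt h x).2) (by simp only [Prod.mk.eta, Multiset.insert_eq_cons]) hey hex' hyc hxy'
        have e1 : pt h ((crt h y).1 + 20) (crt h y).2 = pt h (crt h y).1 (crt h y).2 + pt h 20 0 := by rw [pt_add, add_zero]
        rw [← pt_crt h x, he', hc', e1, pt_crt, twentyP_eq_pt h hp h7]
      push Not at hxc hyc
      exact ⟨x, y, hsx, hx1, shift_of_fibre_zero h hp h7 hs hind hsx hx1 hy1 hz0 hw0 hxc hyc⟩
    obtain ⟨x', y', hs', hx'1, rfl⟩ := hshift
    rcases case_two_odd h hp h19 hs hs' hx'1 hz0 hw0 hex with e | e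
    · exact ⟨x', Or.inl e⟩
    · exact ⟨x', Or.inr (Or.inl e)⟩
  · -- four odd members
    have h0 : se = 0 := Multiset.card_eq_zero.mp (by omega)
    rw [h0, add_zero] at hsplit
    exact (case_all_odd h hp h19 hs hcard hind (fun v hv ↦ hso1 v (hsplit ▸ hv)) hex).elim

end FortyPrimeClassification

end Literature.AlgebraicGeometry.Shioda1982
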